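import Literature.NumberTheory.Automorphic.AdelicUnitaryGroupSpectrum
import Literature.NumberTheory.Automorphic.AutomorphicQuotientKernelCompact
import Literature.NumberTheory.Automorphic.AutomorphicQuotientKernelConvolution
import Literature.NumberTheory.Automorphic.AutomorphicQuotientDiagonalTrace
import Literature.NumberTheory.Automorphic.AutomorphicQuotientDiagonalTracePolar
import Literature.NumberTheory.Automorphic.UnitaryGroupOrbitalTerms
import Literature.NumberTheory.Automorphic.UnitaryGroupOrbitalTermsAnisotropic
import Literature.NumberTheory.Automorphic.UnitaryGroupTransferAwayH
import Literature.NumberTheory.Rogawski1990.TestFunctions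
import Summits.HodgeConjecture.HodgeConjecture.Theorems.F0P3aStubS1TraceFunctional
import Summits.HodgeConjecture.HodgeConjecture.Theorems.F0P3aStubS2LocallyQuasiSplit
import Summits.HodgeConjecture.HodgeConjecture.Theorems.F0P3aFactA2Multiplicity
import Summits.HodgeConjecture.HodgeConjecture.Theorems.F0P3aStubS3SplitFormMeasure
import Literature.NumberTheory.Automorphic.UnitaryGroupTransferAway
import Literature.NumberTheory.Automorphic.UnitaryGroupTransferAwayPartner
import Literature.NumberTheory.Automorphic.AutomorphicQuotientSpectralExpansionPolar
import Literature.NumberTheory.Automorphic.LocalUnitaryGroupSimilitudeLevel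
import Literature.NumberTheory.Rogawski1990.TransferFactsCanonicalSingular
import Literature.NumberTheory.Rogawski1990.PureTensorCentralValues
import Literature.NumberTheory.Automorphic.AdelicUnitaryGroupMeasure
import Literature.NumberTheory.Rogawski1990.TestFunctionsNonempty
import Literature.NumberTheory.Rogawski1990.LocalTransferFundamentalLemma
import Literature.NumberTheory.Rogawski1990.TestFunctionsAssemble
import Literature.NumberTheory.Rogawski1990.GlobalTransferFactor
import Literature.NumberTheory.Rogawski1990.ArchimedeanTransfer
import Literature.NumberTheory.Rogawski1990.LocalTransferCertification
import Literature.NumberTheory.Rogawski1990.TransferFactsCanonical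
import Literature.NumberTheory.Rogawski1990.TransferFactsStabilisation
import Literature.NumberTheory.Automorphic.CompactCoreLevelConj
import Literature.NumberTheory.Automorphic.CompactCoreCentralizerLevelOfIntegralConjugacy
import Literature.NumberTheory.Automorphic.UnitaryGroupOrbitalMeasureFamilyOfLocal
import Literature.NumberTheory.Rogawski1990.RegularEltLocalisation
import Literature.NumberTheory.Automorphic.UnitaryGroupAbsorbedFamilyOfLocalPatched
import Literature.NumberTheory.Rogawski1990.TransferFactsMatrices
import Literature.NumberTheory.Rogawski1990.SplitSingularRegularity
import Literature.NumberTheory.Automorphic.UnitaryGroupOfLocalAdelicCongr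
import Literature.NumberTheory.Rogawski1990.SingularTransferMembers
import Literature.NumberTheory.Rogawski1990.AdelicStableOrbitalIntegral
import Literature.NumberTheory.Rogawski1990.EndoscopicClassTransfer
import Literature.NumberTheory.Automorphic.UnitaryGroupOrbitalMeasureFamilyOfLocalAdelic
import Literature.NumberTheory.Automorphic.OrbitalMeasureFamilyTransport
import Literature.NumberTheory.Rogawski1990.AdelicStableClassesInvariance
import Literature.NumberTheory.Rogawski1990.StableClassRegular
import Literature.NumberTheory.Rogawski1990.AdelicStableOrbitalEulerTransport
import Literature.NumberTheory.Automorphic.UnitaryGroupAdelicHaarOfLocal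
import Literature.NumberTheory.Automorphic.LocalUnitaryGroupUnimodularIsotropic
import Literature.NumberTheory.Rogawski1990.AdelicStableClassSupportFinite
import Literature.NumberTheory.Automorphic.UnitaryGroupPairOrbitalMeasureFamilyOfLocalAdelic
import Literature.NumberTheory.Rogawski1990.AdelicStableOrbitalEulerDischargeH
import Literature.NumberTheory.Rogawski1990.AdelicStableClassSupportFiniteH
import Literature.NumberTheory.Rogawski1990.StableClassHRegular
import Literature.NumberTheory.Automorphic.UnitaryGroupAbsorbedFamilyStableWeight
import Literature.NumberTheory.Automorphic.UnitaryGroupOfLocalCovolumeStableKit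
import Literature.NumberTheory.Rogawski1990.AnchoredStableSJH
import HarnessLib
import Literature.NumberTheory.Rogawski1990.AnchoredStableSJG

/-! # F0 · T1 inner-form trace identity — KIT module (split edition ed. 1.24b; RULING #118 (3), LEAD WORD #121)

This module is the byte-prefix §0–§3.9 of the engine workfile `Lines/F0_T1InnerFormTraceIdentity.lean` (crux `H413`, line
`F0-T1InnerFormTraceIdentity`): §0 the CONCRETE groups; §1 the comparison kit `ComparisonKit` (DATA over `UnitaryGroup.cmDatum L 3 H`, no kit
asserted to exist) with its NAMED pins and `ComparisonKit.IsPinned` (one pin per conjunct, only ever APPENDED); §2 `LawsT1` (the printed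
identities read over the kit, nothing asserted); §3 the heads as definitions; §3.9 the anchored κ values.  The three REGISTERED stubs, §5 (the
`AnchorWitness` realisation of a pinned kit from the stubs with the printed transfer facts as HYPOTHESES) and the byte-stable HEAD
`engineT1_of_stubs` stay in the MAIN module `Lines/F0_T1InnerFormTraceIdentity.lean`, which imports this one; the per-pin BY-NAME lemmas live in
`Lines/F0_T1InnerFormTraceIdentityAPI.lean`; the card is `Lines/F0_T1InnerFormTraceIdentity.md`.  Same namespace in all three modules, so every
fully-qualified name is unchanged by the split (zero token change inside the moved region).  HC_CM is proved only modulo the printed citations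
until rung 0 closes.  (print: Rogawski1990, §§14.1–14.5 pp. 232–241; §4.3 pp. 43–44; §4.9 pp. 54–55; §5.4 pp. 72–77)
-/

-- the mandated namespace has the single-problem summit's repeated segment, as in every `Cruxes/…/Lines/*.lean` of this sub-problem
set_option linter.dupNamespace false

noncomputable section

namespace Summit.HodgeConjecture.HodgeConjecture.Cruxes.H413.F0T1InnerFormTraceIdentity

open MeasureTheory Measure NumberField IsDedekindDomain
open Literature.NumberTheory.Automorphic
open Literature.AlgebraicGeometry.ShimuraVarieties (hermForm)
open scoped ENNReal NNReal

variable (L : Type) [Field L] [NumberField L] [IsCMField L]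

/-! ## §0 The groups — CONCRETE, in the tree by name -/

/-- One currency with the parent∕P2∕P4 (ENGINE-INTERFACES §0; F0-typ1's cert): the tree's two names for `U(H)(𝔸_{L⁺})` agree definitionally.
[folklore] -/
example (H : Matrix (Fin 3) (Fin 3) L) :
    UnitaryGroup.cmDatum L 3 H = UnitaryGroup.adelicGroupData (↥(maximalRealSubfield L)) L (IsCMField.complexConj L) 3 H := rfl

/-- **`G′` anisotropic**: the hermitian form of `H` has no isotropic vector — Ch. 14's standing hypothesis («Since `G′` is anisotropic», §14.5
p. 237), the hypothesis of ★ `UnitaryGroup.compactSpace_cmDatum_automorphicQuotient`; for the pin's `H` it holds by ★ `UnitaryGroup.anisotropic_of_posDef_map`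
(full text: companion § ed. 1.24b). (print: Rogawski1990, §14.2 p. 232; §14.5 p. 237) -/
def IsAnisotropic (H : Matrix (Fin 3) (Fin 3) L) : Prop :=
  ∀ x : Fin 3 → L, hermForm (cmConjRingHom L) H x x = 0 → x = 0

/-- `H` is HERMITIAN for the CM conjugation: `(c̄H)ᵀ = H` (the tree's `cmDatum` is «meaningful for `H` invertible hermitian»; anisotropic ⇒
invertible). [folklore] -/
def IsHermitianCM (H : Matrix (Fin 3) (Fin 3) L) : Prop :=
  (H.map (cmConjRingHom L)).transpose = H

/-- The split anti-diagonal hermitian form `Φ_N = antidiag(1, …, 1)` on `L^N`: `U(Φ_N)` is the QUASI-SPLIT unitary group in `N` variables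
attached to `L/L⁺` ([Rogawski1990] §1.9's `Φ`, up to the harmless units on the anti-diagonal). (ed. 1.19b₂: an `abbrev`, so that the ★ bricks stated over the
literal `Matrix.of …` apply to `splitForm L N` reducibly.) (print: Rogawski1990, §1.9) -/
abbrev splitForm (N : ℕ) : Matrix (Fin N) (Fin N) L :=
  Matrix.of fun i j => if i.val + j.val + 1 = N then 1 else 0

/-- Adelic points `G′(𝔸_{L⁺}) = U(H)(𝔸_{L⁺})` of the inner form (the tree's `(UnitaryGroup.cmDatum L 3 H).Adelic`). [folklore] -/
abbrev GpAdelic (H : Matrix (Fin 3) (Fin 3) L) : Type := (UnitaryGroup.cmDatum L 3 H).Adelic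

/-- Test functions `C_c(G′(𝔸), ℂ)` on the inner form (the tree's currency for integrated operators; smoothness is the kit's `Smooth`). [folklore] -/
abbrev TestGp (H : Matrix (Fin 3) (Fin 3) L) : Type := CompactlySupportedContinuousMap (GpAdelic L H) ℂ

/-- Adelic points of the quasi-split `G = U(3) = U(Φ₃)`. (print: Rogawski1990, §14.1 p. 232) -/
abbrev GAdelic : Type := (UnitaryGroup.cmDatum L 3 (splitForm L 3)).Adelic

/-- Test functions `C_c(G(𝔸), ℂ)` on the quasi-split `G`. [folklore] -/
abbrev TestG : Type := CompactlySupportedContinuousMap (GAdelic L) ℂ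

/-- Adelic points of the endoscopic group `H = U(2) × U(1) = U(Φ₂) × U(Φ₁)`. (print: Rogawski1990, §4.2; §14.3 pp. 233–234) -/
abbrev HAdelic : Type := (UnitaryGroup.cmDatum L 2 (splitForm L 2)).Adelic × (UnitaryGroup.cmDatum L 1 (splitForm L 1)).Adelic

/-- Test functions `C_c(H(𝔸), ℂ)` on `H = U(2) × U(1)`. [folklore] -/
abbrev TestH : Type := CompactlySupportedContinuousMap (HAdelic L) ℂ

/-- (ed. 1.16) Local points `H(L⁺_v) = U(Φ₂)(L⁺_v) × U(Φ₁)(L⁺_v)` at a finite place `v`, split forms spelled LITERALLY and REDUCIBLY (instance resolution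
on the carriers of ★ `Rogawski1990.LocalTransferFactor` ∕ `IsLocalDeltaTransfer`; full text: companion § ed. 1.24b). (print: Rogawski1990, §4.9 p. 54) -/
abbrev HLocal (v : HeightOneSpectrum (𝓞 ↥(maximalRealSubfield L))) : Type :=
  (UnitaryGroup.cmDatum L 2 (Matrix.of fun i j : Fin 2 => if i.val + j.val + 1 = 2 then (1 : L) else 0)).Local v ×
    (UnitaryGroup.cmDatum L 1 (Matrix.of fun i j : Fin 1 => if i.val + j.val + 1 = 1 then (1 : L) else 0)).Local v

/-- (ed. 1.19a) Local points `G′_v = U(H)(L⁺_v)` of the inner form (reducible abbreviation of the tree's `(UnitaryGroup.cmDatum L 3 H).Local v`, the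
carrier of ★ `GlobalTransferWithFundamentalLemmaCanonical`'s `νG_v`). [folklore] -/
abbrev GpLocal (H : Matrix (Fin 3) (Fin 3) L) (v : HeightOneSpectrum (𝓞 ↥(maximalRealSubfield L))) : Type :=
  (UnitaryGroup.cmDatum L 3 H).Local v

/-- (ed. 1.19a) Archimedean points `G′_∞ = U(H)(L⁺ ⊗ ℝ)` (reducible; the tree's `UnitaryGroup.arch … 3 H`, spelled as in ★ `ArchTransfersExistCanonical`). [folklore] -/
abbrev GpInf (H : Matrix (Fin 3) (Fin 3) L) : Type :=
  ↥(UnitaryGroup.arch (↥(maximalRealSubfield L)) L (IsCMField.complexConj L) 3 H)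

/-- (ed. 1.19a) Archimedean points `G_∞ = U(Φ₃)(L⁺ ⊗ ℝ)` of the quasi-split group (reducible; `Φ₃` SPELLED, as in the ★ facts). [folklore] -/
abbrev GInf : Type :=
  ↥(UnitaryGroup.arch (↥(maximalRealSubfield L)) L (IsCMField.complexConj L) 3 (Matrix.of fun i j : Fin 3 => if i.val + j.val + 1 = 3 then (1 : L) else 0))

/-- (ed. 1.19a) Archimedean points `H_∞ = U(Φ₂)(L⁺ ⊗ ℝ) × U(Φ₁)(L⁺ ⊗ ℝ)` of the endoscopic group (reducible; spelled as in the ★ facts). [folklore] -/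
abbrev HInf : Type :=
  ↥(UnitaryGroup.arch (↥(maximalRealSubfield L)) L (IsCMField.complexConj L) 2 (Matrix.of fun i j : Fin 2 => if i.val + j.val + 1 = 2 then (1 : L) else 0)) ×
    ↥(UnitaryGroup.arch (↥(maximalRealSubfield L)) L (IsCMField.complexConj L) 1 (Matrix.of fun i j : Fin 1 => if i.val + j.val + 1 = 1 then (1 : L) else 0))

/-! ## §1 The comparison kit — POSITED data of [Rogawski1990] §§14.1–14.5 and Chs 10–13 (layer (K)); nothing asserted -/

variable (H : Matrix (Fin 3) (Fin 3) L)
  (μ : Measure (UnitaryGroup.cmDatum L 3 H).automorphicQuotient) [(UnitaryGroup.cmDatum L 3 H).IsAutomorphicMeasure μ]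

/-- **Comparison kit for `(G′, G, H)`** [Rogawski1990, §§14.1–14.5] over the concrete groups of §0 — DATA ONLY (no kit asserted to exist; the anchored
part is REALISED from the stubs in §5; pins = `IsPinned`, printed identities = §2; field ↦ printed-object table and the full docstring: card § «ComparisonKit
fields», companion § ed. 1.24b). (print: Rogawski1990, §14.1–14.5 pp. 232–241) -/
structure ComparisonKit where
  /-- `θ_{G′}` as a ℂ-linear functional on `C_c(G′(𝔸))` [§14.5 p. 237] -/
  traceGp : TestGp L H →ₗ[ℂ] ℂ
  /-- `m(π)` for discrete automorphic `π` of `G′` [§14.5–14.6] -/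
  mult : DiscreteAutomorphicRep (UnitaryGroup.cmDatum L 3 H) μ → ℕ
  /-- automorphic measure on `G(F)\G(𝔸)`, `G = U(Φ₃)` quasi-split [Ch. 9–10] -/
  μG : Measure (UnitaryGroup.cmDatum L 3 (splitForm L 3)).automorphicQuotient
  /-- the local identifications `ψ_v : G′_v ≅ G_v` at EVERY finite place `v` of `L⁺` [§14.1–14.2 p. 232: «we fix an inner isomorphism
  `ψ : G′ → G`»; (i)–(iii): for `D = M₃(E)` the set `S` is empty, so `G′_v ≅ G_v` for all finite `v`] — exist by S2 -/
  ψ : ∀ v : HeightOneSpectrum (𝓞 ↥(maximalRealSubfield L)),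
    (UnitaryGroup.cmDatum L 3 H).Local v ≃ₜ* (UnitaryGroup.cmDatum L 3 (splitForm L 3)).Local v
  /-- smooth `K`-finite test functions on `G′(𝔸)` [§14.2] -/
  Smooth : TestGp L H → Prop
  /-- `f′ ↦ f` (14.2.1) -/
  Transfer : TestGp L H → TestG L → Prop
  /-- `f′ ↦ f′^H` (§14.3) -/
  TransferH : TestGp L H → TestH L → Prop
  /-- (ed. 1.18) the local transfer factors `Δ_v = Δ_{G∕H}` at the finite places — ONE collection for the whole kit [§4.9 p. 54; (4.3.3) p. 44] -/
  Δ : ∀ v : HeightOneSpectrum (𝓞 ↥(maximalRealSubfield L)), Literature.NumberTheory.Rogawski1990.LocalTransferFactor L H v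
  /-- (ed. 1.18) the orbital measure families `m^H_v` on `H_v = U(Φ₂)_v × U(Φ₁)_v` (Borel orbit quotients) [§4.3 pp. 43–44] -/
  mH : letI : ∀ (v : HeightOneSpectrum (𝓞 ↥(maximalRealSubfield L))) (a : HLocal L v),
        MeasurableSpace (HLocal L v ⧸ Subgroup.centralizer ({a} : Set (HLocal L v))) := fun _ _ => borel _;
    ∀ v, OrbitalMeasureFamily (HLocal L v)
  /-- (ed. 1.18) the orbital measure families `m^{G′}_v` on `G′_v = U(H)(L⁺_v)` [§4.3 pp. 43–44; §14.2 p. 232] -/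
  mG : letI : ∀ (v : HeightOneSpectrum (𝓞 ↥(maximalRealSubfield L))) (γ : (UnitaryGroup.cmDatum L 3 H).Local v),
        MeasurableSpace ((UnitaryGroup.cmDatum L 3 H).Local v ⧸
          Subgroup.centralizer ({γ} : Set ((UnitaryGroup.cmDatum L 3 H).Local v))) := fun _ _ => borel _;
    ∀ v, OrbitalMeasureFamily ((UnitaryGroup.cmDatum L 3 H).Local v)
  /-- (ed. 1.18) the orbital measure family `m^H_∞` on `H_∞` [§14.3 p. 234] -/
  mHi : letI : ∀ a : (UnitaryGroup.arch (↥(maximalRealSubfield L)) L (IsCMField.complexConj L) 2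
            (Matrix.of fun i j : Fin 2 => if i.val + j.val + 1 = 2 then (1 : L) else 0) ×
          UnitaryGroup.arch (↥(maximalRealSubfield L)) L (IsCMField.complexConj L) 1
            (Matrix.of fun i j : Fin 1 => if i.val + j.val + 1 = 1 then (1 : L) else 0)),
        MeasurableSpace ((UnitaryGroup.arch (↥(maximalRealSubfield L)) L (IsCMField.complexConj L) 2
            (Matrix.of fun i j : Fin 2 => if i.val + j.val + 1 = 2 then (1 : L) else 0) ×
          UnitaryGroup.arch (↥(maximalRealSubfield L)) L (IsCMField.complexConj L) 1
            (Matrix.of fun i j : Fin 1 => if i.val + j.val + 1 = 1 then (1 : L) else 0)) ⧸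
          Subgroup.centralizer ({a} : Set (UnitaryGroup.arch (↥(maximalRealSubfield L)) L (IsCMField.complexConj L) 2
            (Matrix.of fun i j : Fin 2 => if i.val + j.val + 1 = 2 then (1 : L) else 0) ×
          UnitaryGroup.arch (↥(maximalRealSubfield L)) L (IsCMField.complexConj L) 1
            (Matrix.of fun i j : Fin 1 => if i.val + j.val + 1 = 1 then (1 : L) else 0)))) := fun _ => borel _;
    OrbitalMeasureFamily (UnitaryGroup.arch (↥(maximalRealSubfield L)) L (IsCMField.complexConj L) 2
            (Matrix.of fun i j : Fin 2 => if i.val + j.val + 1 = 2 then (1 : L) else 0) ×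
          UnitaryGroup.arch (↥(maximalRealSubfield L)) L (IsCMField.complexConj L) 1
            (Matrix.of fun i j : Fin 1 => if i.val + j.val + 1 = 1 then (1 : L) else 0))
  /-- (ed. 1.18) the orbital measure family `m^{G′}_∞` on `G′_∞` — serves BOTH (14.2.1) at `∞` (ix′) and the Δ_∞-transfer (xi″) [§14.2 p. 233; §14.3 p. 234] -/
  mGi : letI : ∀ γ : UnitaryGroup.arch (↥(maximalRealSubfield L)) L (IsCMField.complexConj L) 3 H,
        MeasurableSpace (UnitaryGroup.arch (↥(maximalRealSubfield L)) L (IsCMField.complexConj L) 3 H ⧸ Subgroup.centralizer ({γ} : Set (UnitaryGroup.arch (↥(maximalRealSubfield L)) L (IsCMField.complexConj L) 3 H))) := fun _ => borel _;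
    OrbitalMeasureFamily (UnitaryGroup.arch (↥(maximalRealSubfield L)) L (IsCMField.complexConj L) 3 H)
  /-- (ed. 1.18) the orbital measure family `m_∞` on `G_∞ = U(Φ₃)_∞` [§14.2 p. 233] -/
  mqi : letI : ∀ γ : UnitaryGroup.arch (↥(maximalRealSubfield L)) L (IsCMField.complexConj L) 3
          (Matrix.of fun i j : Fin 3 => if i.val + j.val + 1 = 3 then (1 : L) else 0),
        MeasurableSpace (UnitaryGroup.arch (↥(maximalRealSubfield L)) L (IsCMField.complexConj L) 3
          (Matrix.of fun i j : Fin 3 => if i.val + j.val + 1 = 3 then (1 : L) else 0) ⧸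
          Subgroup.centralizer ({γ} : Set (UnitaryGroup.arch (↥(maximalRealSubfield L)) L (IsCMField.complexConj L) 3
          (Matrix.of fun i j : Fin 3 => if i.val + j.val + 1 = 3 then (1 : L) else 0)))) := fun _ => borel _;
    OrbitalMeasureFamily (UnitaryGroup.arch (↥(maximalRealSubfield L)) L (IsCMField.complexConj L) 3
          (Matrix.of fun i j : Fin 3 => if i.val + j.val + 1 = 3 then (1 : L) else 0))
  /-- (ed. 1.18) ONE adelic orbital measure family `μ_{[γ]}` on `U(H)(𝔸) ⧸ U(H)(𝔸)_γ` over the rational classes `[γ]` of `G′(L⁺) = U(H)(L⁺)` — the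
  J-side currency (★ `UnitaryGroup.AdelicOrbitalMeasureFamily`) [§14.5 p. 237; §5.4 (5.4.3) p. 72] -/
  μA : letI : ∀ g : GpAdelic L H, MeasurableSpace (GpAdelic L H ⧸ Subgroup.centralizer ({g} : Set (GpAdelic L H))) := fun _ => borel _;
    UnitaryGroup.AdelicOrbitalMeasureFamily L 3 H
  /-- stable semisimple classes of `G` mod `Z` [§14.1] -/
  StClass : Type
  /-- `J(𝒪_st, f′)` [p. 238] -/
  J : StClass → TestGp L H → ℂ
  /-- (ed. 1.19a) `StClass` IS the tree's set of stable semisimple classes of `U(H)(L⁺)` (★ `Rogawski1990.StableClass`) along this bijection [§14.1 p. 232] -/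
  eSt : StClass ≃ Literature.NumberTheory.Rogawski1990.StableClass (cmConjRingHom L) H
  /-- (ed. 1.18∕1.22) the stable-class weights `α(𝒪_st)` — DATA: the `J`-side class weight `α(𝒪) = a(𝒪)` of [§5.4 (5.4.1) p. 72; §14.5 p. 237], in the
  no-centre dictionary the COVOLUME weight, constant on the stable class; under pin (κ-v) `½ κ_H = α κ_G` — read by the SJ sockets (xii″)∕(xiii″) and (κ-v)
  (full text: companion § ed. 1.24b) [§5.4 (5.4.1)–(5.4.3) pp. 72–73; Prop. 10.1.2; §14.5 p. 237] -/
  α : StClass → ℝ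
  /-- `SJ(𝒪_st, f)` [Thm. 14.5.1 (a)] -/
  SJG : StClass → TestG L → ℂ
  /-- stable semisimple classes of `H` mod `Z` -/
  StClassH : Type
  /-- `SJ(𝒪′_st, f^H)` -/
  SJH : StClassH → TestH L → ℂ
  /-- `𝒪′_st` transfers to `𝒪_st` [p. 238] -/
  transfersTo : StClassH → StClass → Prop
  /-- (ed. 1.19c₁) the identification of `StClassH` with the tree's ★ `Rogawski1990.StableClassH (cmConjRingHom L) Φ₂ Φ₁` (DATA, like `eSt`) [§14.1 p. 232; p. 238] -/
  eStH : StClassH ≃ Literature.NumberTheory.Rogawski1990.StableClassH (cmConjRingHom L) (splitForm L 2) (splitForm L 1)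
  /-- (ed. 1.19c₁) the SJ normalising constants `κ_G(𝒪_st) > 0` of `SJ_G = α · κ_G · Φ^{st,𝐀}_G` [§5.4 (5.4.3) p. 72; Thm. 14.5.1 (a) p. 238] -/
  κG : StClass → ℝ
  /-- (ed. 1.19c₁) the SJ normalising constants `κ_H(𝒪′_st) > 0` of `SJ_H = κ_H · Φ^{st,𝐀}_H` [§5.4 (5.4.3) p. 72; Thm. 14.5.1 (a) p. 238] -/
  κH : StClassH → ℝ
  /-- `Sθ_G` [Thm. 10.3.1] -/
  SθG : TestG L → ℂ
  /-- `Sθ_H` [Prop. 11.2.1] -/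
  SθH : TestH L → ℂ
  /-- `Sθ_M(f)` [pp. 240–241] -/
  SθM : TestG L → ℂ
  /-- `SJ_M(f)` [pp. 240–241] -/
  SJM : TestG L → ℂ
  /-- `Sθ_{M_H}(f^H)` [pp. 240–241] -/
  SθMH : TestH L → ℂ
  /-- `SJ_{M_H}(f^H)` [pp. 240–241] -/
  SJMH : TestH L → ℂ
  /-- global packets `Π(G)` [§13.3] -/
  PacketG : Type
  /-- global packets `Π(H)` -/
  PacketH : Type
  /-- `n(Π)` [Thm. 13.3.7] -/
  nG : PacketG → ℂ
  /-- `n(ρ)` [§13.3, Prop. 13.6.1] -/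
  nH : PacketH → ℂ
  /-- `Tr Π(f) = Σ_{π ∈ Π} Tr π(f)` -/
  trG : PacketG → TestG L → ℂ
  /-- `Tr ρ(f^H)` -/
  trH : PacketH → TestH L → ℂ

namespace ComparisonKit

variable {L H μ} (𝔨 : ComparisonKit L H μ)

/-! ### §1.0 (ed. 1.19c₁) The SJ-socket texts — the transported local families `m_v := (ψ_v)_* m^{G′}_v` and the G-side pins (xii″)∕(xii-f)∕(xiii-c)∕(κ)
as named `Prop`s over the kit's fields (stated OUTSIDE section `PinnedCanonical`: they take no Haar-measure parameter). -/

/-- **(D1) the TRANSPORTED local families `m_v := (ψ_v)_* m^{G′}_v`** on `G_v = U(Φ₃)(L⁺_v)` (★ `OrbitalMeasureFamily.transport`; canonical by ★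
`OrbitalMeasureFamily.IsCanonical.transport`) — the finite-place currency of `Φ^{st,𝐀}_G` in pin (xii″) (full text: companion § ed. 1.24b).
[Rogawski1990, §14.2 (14.2.1) p. 232; §4.3 p. 43] -/
def mq :
    letI : ∀ (v : HeightOneSpectrum (𝓞 ↥(maximalRealSubfield L))) (γ : (UnitaryGroup.cmDatum L 3 (splitForm L 3)).Local v),
        MeasurableSpace ((UnitaryGroup.cmDatum L 3 (splitForm L 3)).Local v ⧸
          Subgroup.centralizer ({γ} : Set ((UnitaryGroup.cmDatum L 3 (splitForm L 3)).Local v))) := fun _ _ => borel _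
    ∀ v : HeightOneSpectrum (𝓞 ↥(maximalRealSubfield L)), OrbitalMeasureFamily ((UnitaryGroup.cmDatum L 3 (splitForm L 3)).Local v) :=
  letI : ∀ (v : HeightOneSpectrum (𝓞 ↥(maximalRealSubfield L))) (γ : (UnitaryGroup.cmDatum L 3 H).Local v),
      MeasurableSpace ((UnitaryGroup.cmDatum L 3 H).Local v ⧸ Subgroup.centralizer ({γ} : Set ((UnitaryGroup.cmDatum L 3 H).Local v))) :=
    fun _ _ => borel _
  haveI : ∀ (v : HeightOneSpectrum (𝓞 ↥(maximalRealSubfield L))) (γ : (UnitaryGroup.cmDatum L 3 H).Local v),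
      BorelSpace ((UnitaryGroup.cmDatum L 3 H).Local v ⧸ Subgroup.centralizer ({γ} : Set ((UnitaryGroup.cmDatum L 3 H).Local v))) :=
    fun _ _ => ⟨rfl⟩
  letI : ∀ (v : HeightOneSpectrum (𝓞 ↥(maximalRealSubfield L))) (γ : (UnitaryGroup.cmDatum L 3 (splitForm L 3)).Local v),
      MeasurableSpace ((UnitaryGroup.cmDatum L 3 (splitForm L 3)).Local v ⧸
        Subgroup.centralizer ({γ} : Set ((UnitaryGroup.cmDatum L 3 (splitForm L 3)).Local v))) := fun _ _ => borel _
  haveI : ∀ (v : HeightOneSpectrum (𝓞 ↥(maximalRealSubfield L))) (γ : (UnitaryGroup.cmDatum L 3 (splitForm L 3)).Local v),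
      BorelSpace ((UnitaryGroup.cmDatum L 3 (splitForm L 3)).Local v ⧸
        Subgroup.centralizer ({γ} : Set ((UnitaryGroup.cmDatum L 3 (splitForm L 3)).Local v))) := fun _ _ => ⟨rfl⟩
  fun v => (𝔨.mG v).transport (𝔨.ψ v).toMulEquiv (𝔨.ψ v).continuous (𝔨.ψ v).symm.continuous

/-- **(xii″) THE `SJ_G` SOCKET** (text): at every stable class `𝒪` with `eSt 𝒪 = 𝒪_st(γ₀)`, `γ₀` REGULAR (every such representative), and every
`f ∈ C_c(G(𝔸))`: `SJ_G(𝒪, f) = α(𝒪) · κ_G(𝒪) · Φ^{st,𝐀}_G(γ₀; ofLocalAdelic m m_∞; f)` (★ `adelicStableOrbitalIntegralG` over ★ `MatchingAdeleG.classes` at ★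
`UnitaryGroup.OrbitalMeasureFamily.ofLocalAdelic` of (D1) and `mqi`; representative-independent by ★ `adelicStableOrbitalIntegralG_eq_of_isStablyConj`; full text:
companion § ed. 1.24b). [Rogawski1990, Thm. 14.5.1 (a) p. 238; §5.4 (5.4.3) pp. 72–73; §4.3 pp. 43–44] -/
def PinSJG (κG : 𝔨.StClass → ℝ) : Prop :=
  letI : ∀ g : GAdelic L, MeasurableSpace (GAdelic L ⧸ Subgroup.centralizer ({g} : Set (GAdelic L))) := fun _ => borel _
  letI : ∀ γ : GInf L, MeasurableSpace (GInf L ⧸ Subgroup.centralizer ({γ} : Set (GInf L))) := fun _ => borel _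
  letI : ∀ (v : HeightOneSpectrum (𝓞 ↥(maximalRealSubfield L))) (γ : (UnitaryGroup.cmDatum L 3 (splitForm L 3)).Local v),
      MeasurableSpace ((UnitaryGroup.cmDatum L 3 (splitForm L 3)).Local v ⧸
        Subgroup.centralizer ({γ} : Set ((UnitaryGroup.cmDatum L 3 (splitForm L 3)).Local v))) := fun _ _ => borel _
  ∀ (𝒪 : 𝔨.StClass) (γ₀ : (UnitaryGroup.cmDatum L 3 H).Rational),
    𝔨.eSt 𝒪 = Literature.NumberTheory.Rogawski1990.stableClassOf (cmConjRingHom L) H γ₀ →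
    Literature.NumberTheory.Rogawski1990.IsRegularElt (γ₀.val : GL (Fin 3) L) →
    ∀ f : TestG L, 𝔨.SJG 𝒪 f = ((𝔨.α 𝒪 * κG 𝒪 : ℝ) : ℂ) *
      Literature.NumberTheory.Rogawski1990.adelicStableOrbitalIntegralG L H γ₀
        (UnitaryGroup.OrbitalMeasureFamily.ofLocalAdelic L 3 (splitForm L 3) 𝔨.mq 𝔨.mqi) ⇑f

/-- **(xii-f) FINITE SUPPORT of `𝒪 ↦ SJ_G(𝒪, f)`** (text) — the ★ StableSide summability input `hSJG` BY NAME (for the anchored kit: ★ (SF-st)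
`finite_setOf_stableClass_adelicStableOrbitalIntegralG_ne_zero`, compact support meets finitely many regular stable classes). [Rogawski1990, §14.5 p. 238; §4.3 p. 44] -/
def PinSJGFinite : Prop := ∀ f : TestG L, (Function.support fun 𝒪 => 𝔨.SJG 𝒪 f).Finite

/-- **(xiii-c) `transfersTo` PINNED** (text) to the tree's ★ `StableClassH.TransfersTo` («`𝒪′_st ↦ 𝒪_st` under `ξ_H`», ★ `EndoscopicClassTransfer`) along `eStH`∕`eSt`;
so `{𝒪H | transfersTo 𝒪H 𝒪}` is FINITE (★ `StableClassH.finite_subtype_transfersTo_antidiagOne`, per-pin lemma `finite_transfersTo_of_pin`). [Rogawski1990, Thm. 14.5.1 (a) p. 238; §4.6 p. 49] -/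
def PinTransfersTo
    (eStH : 𝔨.StClassH ≃ Literature.NumberTheory.Rogawski1990.StableClassH (cmConjRingHom L) (splitForm L 2) (splitForm L 1)) : Prop :=
  ∀ (𝒪H : 𝔨.StClassH) (𝒪 : 𝔨.StClass),
    𝔨.transfersTo 𝒪H 𝒪 ↔ (eStH 𝒪H).TransfersTo H Literature.NumberTheory.Rogawski1990.endoForm_antidiagOne (𝔨.eSt 𝒪)

/-- **(κ) POSITIVITY of the SJ normalising constants** `κ_G(𝒪) > 0`, `κ_H(𝒪H) > 0` (text). [Rogawski1990, §5.4 (5.4.3) p. 72] -/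
def PinKappa (κG : 𝔨.StClass → ℝ) (κH : 𝔨.StClassH → ℝ) : Prop := (∀ 𝒪, 0 < κG 𝒪) ∧ ∀ 𝒪H, 0 < κH 𝒪H

/-- **(κ-v) the VALUES of the SJ normalising constants** (ed. 1.20): `κ_G(𝒪) = |𝓡(𝒪)|⁻¹`, `|𝓡(𝒪)| = #{𝒪H ↦ 𝒪} + 1`, and `κ_H(𝒪H) = 2 · α(𝒪) · |𝓡(𝒪)|⁻¹`
for every `H`-class transferring to `𝒪` (off the transfer image `κ_H` is unconstrained); so `½ κ_H(𝒪H) = α(𝒪) κ_G(𝒪)` class by class.  CAVEAT (ref1 W17): the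
sockets read `κ_G` only at REGULAR classes (full text: companion § ed. 1.24b). [Rogawski1990, Prop. 5.4.1 (5.4.3)–(5.4.5) pp. 73–74;
Thm. 14.5.1 (a) p. 238] -/
def PinKappaValues (κG : 𝔨.StClass → ℝ) (κH : 𝔨.StClassH → ℝ) : Prop :=
  (∀ 𝒪 : 𝔨.StClass, κG 𝒪 = ((Nat.card {𝒪H : 𝔨.StClassH // 𝔨.transfersTo 𝒪H 𝒪} + 1 : ℕ) : ℝ)⁻¹) ∧
  ∀ (𝒪H : 𝔨.StClassH) (𝒪 : 𝔨.StClass), 𝔨.transfersTo 𝒪H 𝒪 →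
    κH 𝒪H = 2 * 𝔨.α 𝒪 * ((Nat.card {𝒪H' : 𝔨.StClassH // 𝔨.transfersTo 𝒪H' 𝒪} + 1 : ℕ) : ℝ)⁻¹

/-- **(xv) the STABILISATION PACKAGE of the kit's own transfer factor** (ed. 1.21; text over the field `Δ` and `Tinf`): for every REGULAR rational `γ₀`,
Kottwitz's data `(A, 𝓡, obs, e)` on ★ `MatchingAdeleG₂ L H H γ₀` with (ii) HASSE [Prop. 3.3.1] and (iv) the GLOBAL TRANSFER-FACTOR IDENTITY [(4.3.3)] ★
`GlobalKappaFormula L H Δ Tinf.Δ (obs ∘ toSelf hγ) (e 𝒪H)` — the package conjunct of ★ `GlobalTransferWithStabilisationPackage` (`hGT₄`) read for THIS `Δ` (a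
free-standing `∀ Δ` form would be false; full text: companion § ed. 1.24b). [Rogawski1990, §3.3 Prop. 3.3.1 p. 22; §4.3 (4.3.3) pp. 43–44; §5.4 (5.4.5) pp. 72–74;
§14.3 pp. 233–234] [Kottwitz1986, §2.6, Prop. 7.1, §9] [LanglandsShelstad1987, §6.4] -/
def PinStabilisationPackage (Tinf : Literature.NumberTheory.Rogawski1990.ArchTransferFactor L H) : Prop :=
  ∀ γ₀ : (UnitaryGroup.cmDatum L 3 H).Rational, Literature.NumberTheory.Rogawski1990.IsRegularElt (γ₀.val : GL (Fin 3) L) →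
    ∃ (A : Type) (_ : AddCommGroup A) (𝓡 : Subgroup (AddChar A ℂ)) (_ : Fintype 𝓡) (obs : Literature.NumberTheory.Rogawski1990.MatchingAdeleG₂ L H H γ₀ → A)
      (e : {𝒪H : Literature.NumberTheory.Rogawski1990.StableClassH (cmConjRingHom L) (splitForm L 2) (splitForm L 1) //
          𝒪H.TransfersTo H Literature.NumberTheory.Rogawski1990.endoForm_antidiagOne (Literature.NumberTheory.Rogawski1990.stableClassOf (cmConjRingHom L) H γ₀)} ≃ {χ : 𝓡 // χ ≠ 1}),
      (∀ p : Literature.NumberTheory.Rogawski1990.MatchingAdeleG₂ L H H γ₀, (∀ κ ∈ 𝓡, κ (obs p) = 1) ↔ ∃ γ, p.IsRationalOver γ) ∧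
      ∀ (γH : (UnitaryGroup.cmDatum L 2 (splitForm L 2)).Rational × (UnitaryGroup.cmDatum L 1 (splitForm L 1)).Rational)
        (hγ : Literature.NumberTheory.Rogawski1990.IsNormPair L H γH γ₀),
        Literature.NumberTheory.Rogawski1990.GlobalKappaFormula L H 𝔨.Δ Tinf.Δ (fun p : Literature.NumberTheory.Rogawski1990.MatchingAdele L H γH => obs (Literature.NumberTheory.Rogawski1990.MatchingAdele.toSelf hγ p))
          ((e ⟨Literature.NumberTheory.Rogawski1990.stableClassHOf (cmConjRingHom L) _ _ γH, hγ⟩).1 : AddChar A ℂ)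


/-- **(viii⁵) THE STABLE β-PIN** (ed. 1.23, text; RULING #105 (2)): at every REGULAR rational class `c`, `μA c = α(𝒪_st(c)) • ofLocal m^{G′} m^{G′}_∞ c`
(★ `AdelicOrbitalMeasureFamily.ofLocal`, weight read through `eSt` at ★ `StableClass.ofConjClass c`) — constant along the stable class, print's covolume
`a(γ)` [(5.4.1) p. 72; §14.5 p. 237]; the input of API `IsPinned.j_eq_sjG_add_half_sjHover_of_isRegularElt`; positivity is pin (viii′) (full text: companion
§ ed. 1.24b). [Rogawski1990, §4.3 (4.3.1)–(4.3.2) pp. 43–44; §5.4 (5.4.1)–(5.4.3)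
pp. 72–73; §14.5 p. 237] -/
def PinStableBeta : Prop :=
  letI : ∀ g : GpAdelic L H, MeasurableSpace (GpAdelic L H ⧸ Subgroup.centralizer ({g} : Set (GpAdelic L H))) := fun _ => borel _
  letI : ∀ γ : GpInf L H, MeasurableSpace (GpInf L H ⧸ Subgroup.centralizer ({γ} : Set (GpInf L H))) := fun _ => borel _
  letI : ∀ (v : HeightOneSpectrum (𝓞 ↥(maximalRealSubfield L))) (γ : (UnitaryGroup.cmDatum L 3 H).Local v),
      MeasurableSpace ((UnitaryGroup.cmDatum L 3 H).Local v ⧸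
        Subgroup.centralizer ({γ} : Set ((UnitaryGroup.cmDatum L 3 H).Local v))) := fun _ _ => borel _
  ∀ c : ConjClasses (UnitaryGroup.cmDatum L 3 H).Rational,
    Literature.NumberTheory.Rogawski1990.IsRegularElt ((Quotient.out c).val : GL (Fin 3) L) →
      𝔨.μA c = ENNReal.ofReal (𝔨.α (𝔨.eSt.symm (Literature.NumberTheory.Rogawski1990.StableClass.ofConjClass c))) •
        UnitaryGroup.AdelicOrbitalMeasureFamily.ofLocal L 3 H 𝔨.mG 𝔨.mGi c

/-- **`Matches f′ f f^H`** (ENGINE-INTERFACES §1: transfer as a RELATION, never a construction): `f′ → f` (14.2.1) and `f′ → f′^H` (§14.3).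
(print: Rogawski1990, (14.2.1) p. 232; §14.3 pp. 233–234) -/
def Matches (f' : TestGp L H) (f : TestG L) (fH : TestH L) : Prop := 𝔨.Transfer f' f ∧ 𝔨.TransferH f' fH

open Polynomial in
/-- **(xiii‴-cc) `SJ_H` AT THE CLASS WITH CENTRAL IMAGE** (text): for `γH = (ζ • 1₂, h₁)`, `𝒪H = 𝒪′_st(γH)` transferring to a CENTRAL `𝒪`,
`SJ_H(𝒪H, f^H)` is some multiple of `f^H(γH ⊗ 1)` (never read on transfers: (c-c) kills the product). [Rogawski1990, Prop. 10.1.2 (a) p. 146; Lemma 14.5.2 (c) p. 238] -/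
def PinSJHCentralImage : Prop :=
  ∀ (𝒪H : 𝔨.StClassH) (𝒪 : 𝔨.StClass)
    (γH : (UnitaryGroup.cmDatum L 2 (splitForm L 2)).Rational × (UnitaryGroup.cmDatum L 1 (splitForm L 1)).Rational) (ζ : L),
    𝔨.eStH 𝒪H = Literature.NumberTheory.Rogawski1990.stableClassHOf (cmConjRingHom L) (splitForm L 2) (splitForm L 1) γH →
    ((γH.1.val : GL (Fin 2) L) : Matrix (Fin 2) (Fin 2) L) = ζ • (1 : Matrix (Fin 2) (Fin 2) L) →
    𝔨.transfersTo 𝒪H 𝒪 →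
    (∃ γ₀ : (UnitaryGroup.cmDatum L 3 H).Rational,
        𝔨.eSt 𝒪 = Literature.NumberTheory.Rogawski1990.stableClassOf (cmConjRingHom L) H γ₀ ∧
        ((γ₀.val : GL (Fin 3) L) : Matrix (Fin 3) (Fin 3) L) = ζ • (1 : Matrix (Fin 3) (Fin 3) L)) →
    ∃ κ : ℂ, ∀ fH : TestH L, 𝔨.SJH 𝒪H fH =
      κ * fH (((UnitaryGroup.cmDatum L 2 (splitForm L 2)).toAdelic γH.1, (UnitaryGroup.cmDatum L 1 (splitForm L 1)).toAdelic γH.2))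

open Polynomial in
/-- **(c-s)** (package clause, PRINTED): on transfers `SJ_H` VANISHES at the `H`-regular classes `[(h₂, a)]`, `charpoly h₂ = (X − a)(X − b)`,
whose image `{a, a, b}` is `G`-singular. [Rogawski1990, Lemma 14.5.2 (a) p. 238] -/
def PinSingularHRegularVanish : Prop :=
  ∀ (f' : TestGp L H) (f : TestG L) (fH : TestH L), 𝔨.Matches f' f fH →
    ∀ (𝒪H : 𝔨.StClassH) (𝒪 : 𝔨.StClass)
      (γH : (UnitaryGroup.cmDatum L 2 (splitForm L 2)).Rational × (UnitaryGroup.cmDatum L 1 (splitForm L 1)).Rational) (a b : L),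
      𝔨.eStH 𝒪H = Literature.NumberTheory.Rogawski1990.stableClassHOf (cmConjRingHom L) (splitForm L 2) (splitForm L 1) γH →
      a ≠ b →
      ((γH.1.val : GL (Fin 2) L) : Matrix (Fin 2) (Fin 2) L).charpoly = (Polynomial.X - Polynomial.C a) * (Polynomial.X - Polynomial.C b) →
      ((γH.2.val : GL (Fin 1) L) : Matrix (Fin 1) (Fin 1) L) = a • (1 : Matrix (Fin 1) (Fin 1) L) →
      𝔨.transfersTo 𝒪H 𝒪 → 𝔨.SJH 𝒪H fH = 0

open Polynomial in
/-- **(xiii-0) `SJ_H` VANISHES OFF THE SEMISIMPLE `H`-CLASSES** (value pin): `SJ_H(𝒪H, ·) = 0` at every stable class `𝒪H` of `H(L⁺)` whose image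
in `U(Φ₃)` is NOT semisimple (print sums over the stable semisimple classes only; the anisotropic `G′(L⁺)` has no other element; this is the input `hvan` of
`ellipticStabilisation_of_parts`). [Rogawski1990, Thm. 14.5.1 (a) p. 238; Prop. 5.4.1 p. 77] -/
def PinSJHOffSemisimple : Prop :=
  ∀ (𝒪H : 𝔨.StClassH) (fH : TestH L),
    ¬ ((𝔨.eStH 𝒪H).endoImage Literature.NumberTheory.Rogawski1990.endoForm_antidiagOne).IsSemisimple → 𝔨.SJH 𝒪H fH = 0

/-- **(viii⁵-s) THE `μA`-SHAPE AT THE SINGULAR NON-CENTRAL CLASSES** (ed. 1.24; SPEC-O7 v2.3a text): at a split-singular non-central rational class `c`,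
`μA c = α(𝒪_st(out c)) • ofLocal mG mGi c` — the kit's families being the PATCHED ones (singular members at `c`). [Rogawski1990, §5.4 (5.4.1) p. 72; §14.5 p. 239; Kottwitz1988 Thm. 1] -/
def PinMuAShapeSingular : Prop :=
  letI : ∀ g : GpAdelic L H, MeasurableSpace (GpAdelic L H ⧸ Subgroup.centralizer ({g} : Set (GpAdelic L H))) := fun _ => borel _
  letI : ∀ γ : GpInf L H, MeasurableSpace (GpInf L H ⧸ Subgroup.centralizer ({γ} : Set (GpInf L H))) := fun _ => borel _
  letI : ∀ (v : HeightOneSpectrum (𝓞 ↥(maximalRealSubfield L))) (γ : (UnitaryGroup.cmDatum L 3 H).Local v),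
      MeasurableSpace ((UnitaryGroup.cmDatum L 3 H).Local v ⧸
        Subgroup.centralizer ({γ} : Set ((UnitaryGroup.cmDatum L 3 H).Local v))) := fun _ _ => borel _
  ∀ (c : ConjClasses (UnitaryGroup.cmDatum L 3 H).Rational) (a b : L), a ≠ b →
    ((((Quotient.out c).val : GL (Fin 3) L) : Matrix (Fin 3) (Fin 3) L) - a • (1 : Matrix (Fin 3) (Fin 3) L)) *
      ((((Quotient.out c).val : GL (Fin 3) L) : Matrix (Fin 3) (Fin 3) L) - b • (1 : Matrix (Fin 3) (Fin 3) L)) = 0 →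
    (¬ ∃ ζ : L, (((Quotient.out c).val : GL (Fin 3) L) : Matrix (Fin 3) (Fin 3) L) = ζ • (1 : Matrix (Fin 3) (Fin 3) L)) →
    𝔨.μA c = ENNReal.ofReal (𝔨.α (𝔨.eSt.symm
        (Literature.NumberTheory.Rogawski1990.stableClassOf (cmConjRingHom L) H (Quotient.out c)))) •
      UnitaryGroup.AdelicOrbitalMeasureFamily.ofLocal L 3 H 𝔨.mG 𝔨.mGi c

/-- **(viii⁵-c) THE `μA`-MASS AT THE CENTRAL CLASSES** (ed. 1.24; SPEC-O7 v2.3a text): at a central rational class `c = [ζ•1]` the total mass of `μA c` is `α` of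
its stable class. [Rogawski1990, Prop. 10.1.2 (b)(2) p. 146; §14.5 p. 237] -/
def PinMuAMassCentral : Prop :=
  letI : ∀ g : GpAdelic L H, MeasurableSpace (GpAdelic L H ⧸ Subgroup.centralizer ({g} : Set (GpAdelic L H))) := fun _ => borel _
  ∀ (c : ConjClasses (UnitaryGroup.cmDatum L 3 H).Rational) (ζ : L),
    (((Quotient.out c).val : GL (Fin 3) L) : Matrix (Fin 3) (Fin 3) L) = ζ • (1 : Matrix (Fin 3) (Fin 3) L) →
    𝔨.μA c Set.univ = ENNReal.ofReal (𝔨.α (𝔨.eSt.symm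
        (Literature.NumberTheory.Rogawski1990.stableClassOf (cmConjRingHom L) H (Quotient.out c))))

/-- **(b-s arch) THE SIGNED ARCHIMEDEAN INNER TRANSFER AT A SPLIT SEMISIMPLE CLASS** (ed. 1.24; A-p16 (g21) v6.1 :949 `PinSingularArchInnerTransferSigned` at
the Kottwitz sign weights `(kottwitzSignArchWeight L 3 H, kottwitzSignArchWeight L 3 Φ₃)` (RULING #116), WITH the two smoothness antecedents under which ★
`SingularEllipticTransferCanonical`'s (ST-∞) clause is stated — the closer holds them from its `IsTest` tensor witnesses): for smooth `T.arch ↦ T′.arch` in the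
(14.2.1) relation for the kit's archimedean families and `γ₀ ↔ γ` with `(γ₀ − a)(γ₀ − b) = 0`, `a ≠ b`, the signed singular archimedean stable orbital integrals agree.
[Rogawski1990, §14.2 (14.2.1) p. 232; Lemma 14.5.2 (b) p. 238; §4.1 (4.1.2)] [Kottwitz1988, Prop. 2] -/
def PinSingularArchInnerTransfer : Prop :=
  letI : ∀ γ : GpInf L H, MeasurableSpace (GpInf L H ⧸ Subgroup.centralizer ({γ} : Set (GpInf L H))) := fun _ => borel _
  letI : ∀ γ : GInf L, MeasurableSpace (GInf L ⧸ Subgroup.centralizer ({γ} : Set (GInf L))) := fun _ => borel _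
  ∀ (T : UnitaryGroup.PureTensor L 3 H) (T' : UnitaryGroup.PureTensor L 3 (splitForm L 3)),
    Literature.NumberTheory.Rogawski1990.ArchSmooth L 3 H T.arch → Literature.NumberTheory.Rogawski1990.ArchSmooth L 3 (splitForm L 3) T'.arch →
    Literature.NumberTheory.Rogawski1990.IsArchInnerTransfer L H 𝔨.mGi 𝔨.mqi T.arch T'.arch →
    ∀ (γ₀ : (UnitaryGroup.cmDatum L 3 H).Rational) (γ : (UnitaryGroup.cmDatum L 3 (splitForm L 3)).Rational) (a b : L),
      Literature.NumberTheory.Rogawski1990.Corresponds (cmConjRingHom L) H (splitForm L 3) γ₀ γ →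
      a ≠ b →
      (((γ₀.val : GL (Fin 3) L) : Matrix (Fin 3) (Fin 3) L) - a • (1 : Matrix (Fin 3) (Fin 3) L)) *
        (((γ₀.val : GL (Fin 3) L) : Matrix (Fin 3) (Fin 3) L) - b • (1 : Matrix (Fin 3) (Fin 3) L)) = 0 →
      Literature.NumberTheory.Rogawski1990.archStableOrbitalIntegral L 3 H 𝔨.mGi
          (fun x => Literature.NumberTheory.Rogawski1990.kottwitzSignArchWeight L 3 H (ConjClasses.mk x) * T.arch x)
          (Literature.NumberTheory.Rogawski1990.cmRationalToArch L 3 H γ₀) =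
        Literature.NumberTheory.Rogawski1990.archStableOrbitalIntegral L 3 (splitForm L 3) 𝔨.mqi
          (fun y => Literature.NumberTheory.Rogawski1990.kottwitzSignArchWeight L 3 (splitForm L 3) (ConjClasses.mk y) * T'.arch y)
          (Literature.NumberTheory.Rogawski1990.cmRationalToArch L 3 (splitForm L 3) γ)


/-- **(c-c) [Lemma 14.5.2 (c)]** (SPEC-O7 v2.3a :241 VERBATIM): on transfers, `f′^H` VANISHES at the central elements `(ζ•1₂, ζ)` of `H(𝔸)`.
Anchor: ★ `ArchCanonicalSingularMatrix.centralH_vanish` + ★ `PureTensor₂.eval_toAdelic_eq_zero_of_arch_eq_zero`. (print: Rogawski1990, Lemma 14.5.2 (c) p. 238) -/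
def PinCentralHVanish : Prop :=
  ∀ (f' : TestGp L H) (fH : TestH L), 𝔨.TransferH f' fH →
    ∀ (γH : (UnitaryGroup.cmDatum L 2 (splitForm L 2)).Rational × (UnitaryGroup.cmDatum L 1 (splitForm L 1)).Rational) (ζ : L),
      ((γH.1.val : GL (Fin 2) L) : Matrix (Fin 2) (Fin 2) L) = ζ • (1 : Matrix (Fin 2) (Fin 2) L) →
      ((γH.2.val : GL (Fin 1) L) : Matrix (Fin 1) (Fin 1) L) = ζ • (1 : Matrix (Fin 1) (Fin 1) L) →
      fH (((UnitaryGroup.cmDatum L 2 (splitForm L 2)).toAdelic γH.1, (UnitaryGroup.cmDatum L 1 (splitForm L 1)).toAdelic γH.2)) = 0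

/-- **(d-c) [§14.5 p. 239; §8.4] at the central elements** (SPEC-O7 v2.3a :251 VERBATIM): on transfers `f′ ↦ f`, `f(ζ•1 ⊗ 1) = f′(ζ•1 ⊗ 1)`.
Anchor: ★ `PureTensor.eval_toAdelic_eq_of_loc_comp_symm_of_central` (★ N3 at the finite places) + ★ `ArchCanonicalSingularMatrix.central_value`.
(print: Rogawski1990, §14.5 p. 239; §8.4) -/
def PinCentralValueTransfer : Prop :=
  ∀ (f' : TestGp L H) (f : TestG L), 𝔨.Transfer f' f →
    ∀ (γ₀ : (UnitaryGroup.cmDatum L 3 H).Rational) (γ : (UnitaryGroup.cmDatum L 3 (splitForm L 3)).Rational) (ζ : L),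
      ((γ₀.val : GL (Fin 3) L) : Matrix (Fin 3) (Fin 3) L) = ζ • (1 : Matrix (Fin 3) (Fin 3) L) →
      ((γ.val : GL (Fin 3) L) : Matrix (Fin 3) (Fin 3) L) = ζ • (1 : Matrix (Fin 3) (Fin 3) L) →
      f ((UnitaryGroup.cmDatum L 3 (splitForm L 3)).toAdelic γ) = f' ((UnitaryGroup.cmDatum L 3 H).toAdelic γ₀)

/-- **(vii-c) `ψ_v` IS MATRIX CONJUGATION** (O7 WORD #26 (2)): `ψ_v g = S⁻¹ g S` for some `S ∈ GL₃(L⁺_v ⊗ L)` at every finite place — what the Kottwitz-sign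
transport reads.  Anchor: ★ `UnitaryGroup.exists_psi_conj_corresponds_forall_levelMatching`. (print: Rogawski1990, §14.1 p. 232) -/
def PinPsiConj : Prop :=
  ∀ v : HeightOneSpectrum (𝓞 ↥(maximalRealSubfield L)), ∃ S : GL (Fin 3) (UnitaryGroup.LocalRing L v),
    ∀ g : (UnitaryGroup.cmDatum L 3 H).Local v, ((𝔨.ψ v g).val : GL (Fin 3) (UnitaryGroup.LocalRing L v)) = S⁻¹ * g.val * S

/-- **(ix-s) THE KIT'S ORBITAL-MEASURE FAMILIES AT THE NON-REGULAR RATIONAL CLASSES** (text; O7 OWNER WORD #20 (3)'s four riders (ix-adm)(ix-admA)(ix-norm)(ix-admAq)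
in their guarded form = the (NR-M) closer's binders `hadmG′ hadmAG′ hpin hadmAG` VERBATIM, bundled as ONE pin so that `IsPinned.lawT1bNonreg` is residual-free for EVERY
pinned kit): at every NON-regular rational `γ₀` of `G′ = U(H)`, `m^{G′}_v` is admissible on the local stable class of `(γ₀)_v` for every finite `v`, `m^{G′}_∞` and `m_∞`
are admissible on the archimedean classes corresponding to `γ₀ ⊗ 1`, and `m^{G′}` is normalised off a finite set at `γ₀`.  Anchor: (F-1)'s `w.hadmG′ ∕ w.hadmAG′ ∕
w.hpin ∕ w.hadmAG` (★ p823212 §3 one-liners). [cite: Rogawski1990, §4.3 pp. 43–44; §14.2 (14.2.1) pp. 232–233; §14.5 p. 239] -/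
def PinSingularFamilies : Prop :=
  letI : ∀ (v : HeightOneSpectrum (𝓞 ↥(maximalRealSubfield L))) (x : (UnitaryGroup.cmDatum L 3 H).Local v),
      MeasurableSpace ((UnitaryGroup.cmDatum L 3 H).Local v ⧸ Subgroup.centralizer ({x} : Set ((UnitaryGroup.cmDatum L 3 H).Local v))) := fun _ _ => borel _
  letI : ∀ γ : GpInf L H, MeasurableSpace (GpInf L H ⧸ Subgroup.centralizer ({γ} : Set (GpInf L H))) := fun _ => borel _
  letI : ∀ γ : GInf L, MeasurableSpace (GInf L ⧸ Subgroup.centralizer ({γ} : Set (GInf L))) := fun _ => borel _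
  ∀ γ₀ : (UnitaryGroup.cmDatum L 3 H).Rational, ¬ Literature.NumberTheory.Rogawski1990.IsRegularElt (γ₀.val : GL (Fin 3) L) →
    (∀ v, (𝔨.mG v).IsAdmissibleOn fun x : (UnitaryGroup.cmDatum L 3 H).Local v =>
        Literature.NumberTheory.Rogawski1990.Corresponds (UnitaryGroup.conjLocal L (IsCMField.complexConj L) v)
          ((UnitaryGroup.adelicForm L 3 H).map (UnitaryGroup.adeleToLocal L v))
          ((UnitaryGroup.adelicForm L 3 H).map (UnitaryGroup.adeleToLocal L v))
          ((UnitaryGroup.cmDatum L 3 H).toLocal v ((UnitaryGroup.cmDatum L 3 H).toAdelic γ₀)) x) ∧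
    (𝔨.mGi.IsAdmissibleOn fun x : GpInf L H =>
        Literature.NumberTheory.Rogawski1990.Corresponds (UnitaryGroup.conjMixed (↥(maximalRealSubfield L)) L (IsCMField.complexConj L)) (UnitaryGroup.archFormOf L 3 H)
          (UnitaryGroup.archFormOf L 3 H) (Literature.NumberTheory.Rogawski1990.cmRationalToArch L 3 H γ₀) x) ∧
    (∃ S₁ : Finset (HeightOneSpectrum (𝓞 ↥(maximalRealSubfield L))),
        UnitaryGroup.IsNormalisedOff L 3 H 𝔨.mG ((UnitaryGroup.cmDatum L 3 H).toAdelic γ₀) S₁) ∧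
    (𝔨.mqi.IsAdmissibleOn fun x : GInf L =>
        Literature.NumberTheory.Rogawski1990.Corresponds (UnitaryGroup.conjMixed (↥(maximalRealSubfield L)) L (IsCMField.complexConj L)) (UnitaryGroup.archFormOf L 3 H)
          (UnitaryGroup.archFormOf L 3 (splitForm L 3)) (Literature.NumberTheory.Rogawski1990.cmRationalToArch L 3 H γ₀) x)

/-- **(xiii″) THE `SJ_H` SOCKET** (ed. 1.19c₂): at every `G`-REGULAR stable class `𝒪′_st` of `H(L⁺) = U(Φ₂)(L⁺) × U(Φ₁)(L⁺)` and every representative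
`γ_H` (along `eStH`), `SJ_H(𝒪′_st, f^H) = κ_H(𝒪′_st) · Φ^{st,𝐀}_H(γ_H; ofLocalAdelicPair m^H m^H_∞; f^H)` (★ `adelicStableOrbitalIntegralH` at ★
`UnitaryGroup.OrbitalMeasureFamily.ofLocalAdelicPair` of `𝔨.mH`, `𝔨.mHi`; singular classes: the O7 pins; full text: companion § ed. 1.24b).
[Rogawski1990, Thm. 14.5.1 (a) p. 238; §5.4 (5.4.3) pp. 72–73; §4.3 p. 44] -/
def PinSJH (eStH : 𝔨.StClassH ≃ Literature.NumberTheory.Rogawski1990.StableClassH (cmConjRingHom L) (splitForm L 2) (splitForm L 1))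
    (κH : 𝔨.StClassH → ℝ) : Prop :=
  letI : ∀ h : HAdelic L, MeasurableSpace (HAdelic L ⧸ Subgroup.centralizer ({h} : Set (HAdelic L))) := fun _ => borel _
  letI : ∀ a : HInf L, MeasurableSpace (HInf L ⧸ Subgroup.centralizer ({a} : Set (HInf L))) := fun _ => borel _
  letI : ∀ (v : HeightOneSpectrum (𝓞 ↥(maximalRealSubfield L))) (a : HLocal L v),
      MeasurableSpace (HLocal L v ⧸ Subgroup.centralizer ({a} : Set (HLocal L v))) := fun _ _ => borel _
  ∀ (𝒪H : 𝔨.StClassH)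
    (γH : (UnitaryGroup.cmDatum L 2 (splitForm L 2)).Rational × (UnitaryGroup.cmDatum L 1 (splitForm L 1)).Rational),
    eStH 𝒪H = Literature.NumberTheory.Rogawski1990.stableClassHOf (cmConjRingHom L) (splitForm L 2) (splitForm L 1) γH →
    Literature.NumberTheory.Rogawski1990.IsGRegular (cmConjRingHom L) (splitForm L 2) (splitForm L 1) (splitForm L 3)
      Literature.NumberTheory.Rogawski1990.endoForm_antidiagOne γH →
    ∀ fH : TestH L, 𝔨.SJH 𝒪H fH = ((κH 𝒪H : ℝ) : ℂ) *
      Literature.NumberTheory.Rogawski1990.adelicStableOrbitalIntegralH L γH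
        (UnitaryGroup.OrbitalMeasureFamily.ofLocalAdelicPair L (splitForm L 2) (splitForm L 1) 𝔨.mH 𝔨.mHi) ⇑fH

/-- **(xiii-f) FINITE SUPPORT of `𝒪′_st ↦ SJ_H(𝒪′_st, f^H)`** (ed. 1.19c₂): only finitely many stable classes of `H(L⁺)` carry a non-zero `SJ_H(·, f^H)` — the
input `hfin` of ★ `StableSide` BY NAME. [Rogawski1990, §14.5 Thm. 14.5.1 (a) p. 238; §5.4 pp. 72–73] -/
def PinSJHFinite : Prop := ∀ fH : TestH L, (Function.support fun 𝒪H => 𝔨.SJH 𝒪H fH).Finite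

/-- **(xii‴-c) `SJ_G` AT THE CENTRAL CLASSES** (text): at `𝒪 = 𝒪_st(γ₀)`, `γ₀ = ζ • 1`, `SJ_G(𝒪, f) = α(𝒪) · f(γ ⊗ 1)` with `γ = ζ • 1 ∈ U(Φ₃)(L⁺)`;
`κ_G` is not read.  HONEST PRINT (ref1 n6; also for (xii″-s)): Prop. 10.1.2 (b)'s extra `Φ^M`∕`f^K` terms vanish for the §14.5 functions (p. 239), so the
kit's `SJG` = print's `SJ_G` on the matching class, extended by the pure formula; every law reads it on transfers only. [Rogawski1990, Prop. 10.1.2 (b)(2) p. 146; §14.5 p. 239] -/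
def PinSJGCentral : Prop :=
  ∀ (𝒪 : 𝔨.StClass) (γ₀ : (UnitaryGroup.cmDatum L 3 H).Rational) (γ : (UnitaryGroup.cmDatum L 3 (splitForm L 3)).Rational) (ζ : L),
    𝔨.eSt 𝒪 = Literature.NumberTheory.Rogawski1990.stableClassOf (cmConjRingHom L) H γ₀ →
    ((γ₀.val : GL (Fin 3) L) : Matrix (Fin 3) (Fin 3) L) = ζ • (1 : Matrix (Fin 3) (Fin 3) L) →
    ((γ.val : GL (Fin 3) L) : Matrix (Fin 3) (Fin 3) L) = ζ • (1 : Matrix (Fin 3) (Fin 3) L) →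
    ∀ f : TestG L, 𝔨.SJG 𝒪 f = ((𝔨.α 𝒪 : ℝ) : ℂ) * f ((UnitaryGroup.cmDatum L 3 (splitForm L 3)).toAdelic γ)

/-- **(xii″-s) `SJ_G` AT THE SINGULAR NON-CENTRAL CLASSES, SIGNED** (RULING #116; = A-p16 (g21) `PinSJGSingularSigned (kottwitzSignWeight L 3 Φ₃)` by `δ`):
`SJ_G(𝒪, f) = (α(𝒪)∕2) · Φ^{e,𝐀}_G(γ₀; ofLocalAdelic mq mqi; f)`, the Kottwitz-SIGNED adelic stable sum ★ `adelicKappaOrbitalIntegralG`.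
[Rogawski1990, Prop. 10.1.2 (b)(1) p. 146; §4.1 (4.1.2) p. 40; §14.5 p. 239] -/
def PinSJGSingular : Prop :=
  letI : ∀ g : GAdelic L, MeasurableSpace (GAdelic L ⧸ Subgroup.centralizer ({g} : Set (GAdelic L))) := fun _ => borel _
  letI : ∀ γ : GInf L, MeasurableSpace (GInf L ⧸ Subgroup.centralizer ({γ} : Set (GInf L))) := fun _ => borel _
  letI : ∀ (v : HeightOneSpectrum (𝓞 ↥(maximalRealSubfield L))) (γ : (UnitaryGroup.cmDatum L 3 (splitForm L 3)).Local v),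
      MeasurableSpace ((UnitaryGroup.cmDatum L 3 (splitForm L 3)).Local v ⧸
        Subgroup.centralizer ({γ} : Set ((UnitaryGroup.cmDatum L 3 (splitForm L 3)).Local v))) := fun _ _ => borel _
  ∀ (𝒪 : 𝔨.StClass) (γ₀ : (UnitaryGroup.cmDatum L 3 H).Rational) (a b : L),
    𝔨.eSt 𝒪 = Literature.NumberTheory.Rogawski1990.stableClassOf (cmConjRingHom L) H γ₀ →
    a ≠ b →
    (((γ₀.val : GL (Fin 3) L) : Matrix (Fin 3) (Fin 3) L) - a • (1 : Matrix (Fin 3) (Fin 3) L)) *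
      (((γ₀.val : GL (Fin 3) L) : Matrix (Fin 3) (Fin 3) L) - b • (1 : Matrix (Fin 3) (Fin 3) L)) = 0 →
    (¬ ∃ ζ : L, ((γ₀.val : GL (Fin 3) L) : Matrix (Fin 3) (Fin 3) L) = ζ • (1 : Matrix (Fin 3) (Fin 3) L)) →
    ∀ f : TestG L, 𝔨.SJG 𝒪 f = ((𝔨.α 𝒪 / 2 : ℝ) : ℂ) *
      Literature.NumberTheory.Rogawski1990.adelicKappaOrbitalIntegralG L H γ₀
        (Literature.NumberTheory.Rogawski1990.kottwitzSignWeight L 3 (splitForm L 3))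
        (UnitaryGroup.OrbitalMeasureFamily.ofLocalAdelic L 3 (splitForm L 3) 𝔨.mq 𝔨.mqi) ⇑f


/-! ### §1.1 The concrete pins (layer (C) ↔ (K)) -/

/-! #### (ed. 1.19a) The local and archimedean Haar measures of print's convention are PARAMETERS of the pins: Borel structures on the local groups
`H_v`, `G′_v` and the archimedean groups `G′_∞`, `G_∞`, `H_∞` by instance binder (section `PinnedCanonical`); the measures themselves are explicit
arguments of `IsPinned` ∕ `ArchCoherence` and implicit in the named projections. -/
/-- **(xiii″-s ⊗ κ-mass) THE SINGULAR ENDOSCOPIC MASS PIN** (text = A-p16 (g21) v6.2 :310, κ-conjunct PLAIN = ★ `SingularEllipticTransferCanonical` (κ-MASS) token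
for token; O7 WORDS #33 (3)∕#41; ref1 n9).  At every singular NON-central class `𝒪 = 𝒪_st(γ₀)` (`(γ₀ − a)(γ₀ − b) = 0`, `a ≠ b`, `γ₀` not scalar), its
central-`U(2)`-block preimage `γH = (a•1₂, b•1₁)` and the class `𝒪H = 𝒪′_st(γH) ↦ 𝒪`, there is ONE scalar `m_H` with BOTH `SJ_H(𝒪H, f^H) = m_H · f^H(γH ⊗ 1)` AND
`α(𝒪) · Σ_{δ ∈ 𝒟(G′_{γ₀}∕𝐀)} Φ(γ₀^δ; ofLocalAdelic mG mGi; T.eval) = m_H · TH.eval(γH ⊗ 1)` for every transfer pair `f′ ↦ f^H` with pure-tensor witnesses `(T, TH)` — the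
UNWEIGHTED sum over ALL adelic classes (★ `adelicStableOrbitalSum` on `MatchingAdeleG₂.classes`), which IS print's `Φ^κ(γ′, f′)` in the signed currency because
`e_v·κ_v ≡ e_v(G′_{γ₀})` placewise and `∏_v e_v(G′_{γ₀}) = 1` [Kottwitz1988; ref1 W19-4] (weight `e_𝐀·κ ≡ 1`); do NOT 'repair' the body into a signed sum.  HONEST PRINT:
`m_H = m(Z_H H_F∖H_𝐀)` for Tamagawa-compatible measures [Prop. 10.1.2 (a) p. 146]; κ-half `Φ^κ(γ₀, f′) = f′^H(γH)` [Lemma 14.5.2 (b) p. 238; Prop. 8.2.1 (a); (4.3.3)];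
the two scalars AGREE because `τ(G′_{γ₀}) = τ(H)` [Kottwitz1988, Thm. 1]; in kit currency `m_H = α(𝒪) · Cs(…)`.
[Rogawski1990, Prop. 10.1.2 (a) p. 146; Lemma 14.5.2 (b) p. 238; §4.3 (4.3.3) p. 44; §4.1 (4.1.2); §14.5 p. 239] [Kottwitz1986, §9] [Kottwitz1988, Thm. 1, Prop. 2] -/
def PinSingularEndoscopicMass : Prop :=
  letI : ∀ g : GpAdelic L H, MeasurableSpace (GpAdelic L H ⧸ Subgroup.centralizer ({g} : Set (GpAdelic L H))) := fun _ => borel _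
  letI : ∀ γ : GpInf L H, MeasurableSpace (GpInf L H ⧸ Subgroup.centralizer ({γ} : Set (GpInf L H))) := fun _ => borel _
  letI : ∀ (v : HeightOneSpectrum (𝓞 ↥(maximalRealSubfield L))) (γ : (UnitaryGroup.cmDatum L 3 H).Local v),
      MeasurableSpace ((UnitaryGroup.cmDatum L 3 H).Local v ⧸
        Subgroup.centralizer ({γ} : Set ((UnitaryGroup.cmDatum L 3 H).Local v))) := fun _ _ => borel _
  ∀ (𝒪 : 𝔨.StClass) (γ₀ : (UnitaryGroup.cmDatum L 3 H).Rational) (a b : L),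
    𝔨.eSt 𝒪 = Literature.NumberTheory.Rogawski1990.stableClassOf (cmConjRingHom L) H γ₀ →
    ∀ (hab : a ≠ b)
      (hγ₀ : (((γ₀.val : GL (Fin 3) L) : Matrix (Fin 3) (Fin 3) L) - a • (1 : Matrix (Fin 3) (Fin 3) L)) *
        (((γ₀.val : GL (Fin 3) L) : Matrix (Fin 3) (Fin 3) L) - b • (1 : Matrix (Fin 3) (Fin 3) L)) = 0),
      (¬ ∃ ζ : L, ((γ₀.val : GL (Fin 3) L) : Matrix (Fin 3) (Fin 3) L) = ζ • (1 : Matrix (Fin 3) (Fin 3) L)) →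
    ∀ (γH : (UnitaryGroup.cmDatum L 2 (splitForm L 2)).Rational × (UnitaryGroup.cmDatum L 1 (splitForm L 1)).Rational),
      ((γH.1.val : GL (Fin 2) L) : Matrix (Fin 2) (Fin 2) L) = a • (1 : Matrix (Fin 2) (Fin 2) L) →
      ((γH.2.val : GL (Fin 1) L) : Matrix (Fin 1) (Fin 1) L) = b • (1 : Matrix (Fin 1) (Fin 1) L) →
    ∀ (𝒪H : 𝔨.StClassH),
      𝔨.eStH 𝒪H = Literature.NumberTheory.Rogawski1990.stableClassHOf (cmConjRingHom L) (splitForm L 2) (splitForm L 1) γH →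
      𝔨.transfersTo 𝒪H 𝒪 →
    ∃ mH : ℂ,
      (∀ fH : TestH L, 𝔨.SJH 𝒪H fH =
        mH * fH (((UnitaryGroup.cmDatum L 2 (splitForm L 2)).toAdelic γH.1, (UnitaryGroup.cmDatum L 1 (splitForm L 1)).toAdelic γH.2))) ∧
      ∀ (f' : TestGp L H) (fH : TestH L), 𝔨.TransferH f' fH →
        ∀ (T : UnitaryGroup.PureTensor L 3 H) (TH : UnitaryGroup.PureTensor₂ L (splitForm L 2) (splitForm L 1)),
          ⇑f' = T.eval → ⇑fH = TH.eval →
          ((𝔨.α 𝒪 : ℝ) : ℂ) *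
              Literature.NumberTheory.Rogawski1990.adelicStableOrbitalSum (Literature.NumberTheory.Rogawski1990.MatchingAdeleG₂.classes L H H γ₀)
                (UnitaryGroup.OrbitalMeasureFamily.ofLocalAdelic L 3 H 𝔨.mG 𝔨.mGi) T.eval =
            mH * TH.eval ((UnitaryGroup.cmDatum L 2 (splitForm L 2)).toAdelic γH.1, (UnitaryGroup.cmDatum L 1 (splitForm L 1)).toAdelic γH.2)

/-- **(ix′-c) THE `Transfer` SOCKET IS THE LOCAL MATCHING PREDICATE** (text; DEFINITIONAL pin, subsumes the forward pin (ix′)): `Transfer f′ f` holds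
IFF `f′ = T.eval`, `f = T′.eval` for TEST pure tensors with `T′_v = T_v ∘ ψ_v⁻¹` at every finite `v` ((14.2.1) at the finite places, `D = M₃(E)`) and
`T′_∞` an archimedean inner transfer of `T_∞` for the kit's families `m^{G′}_∞`, `m_∞` ((14.2.1) at `∞`).  Makes «locally matching data ⇒ `Transfer`»
available to consumers of an ARBITRARY pinned kit (P3's `matchingS`, G-side).  Anchor: `Iff.rfl`. [cite: Rogawski1990, §14.2 (14.2.1) pp. 232–233] -/
def PinTransferIff : Prop :=
  letI : ∀ γ : UnitaryGroup.arch (↥(maximalRealSubfield L)) L (IsCMField.complexConj L) 3 H,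
        MeasurableSpace (UnitaryGroup.arch (↥(maximalRealSubfield L)) L (IsCMField.complexConj L) 3 H ⧸ Subgroup.centralizer ({γ} : Set (UnitaryGroup.arch (↥(maximalRealSubfield L)) L (IsCMField.complexConj L) 3 H))) := fun _ => borel _;
    letI : ∀ γ : UnitaryGroup.arch (↥(maximalRealSubfield L)) L (IsCMField.complexConj L) 3
          (Matrix.of fun i j : Fin 3 => if i.val + j.val + 1 = 3 then (1 : L) else 0),
        MeasurableSpace (UnitaryGroup.arch (↥(maximalRealSubfield L)) L (IsCMField.complexConj L) 3
          (Matrix.of fun i j : Fin 3 => if i.val + j.val + 1 = 3 then (1 : L) else 0) ⧸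
          Subgroup.centralizer ({γ} : Set (UnitaryGroup.arch (↥(maximalRealSubfield L)) L (IsCMField.complexConj L) 3
          (Matrix.of fun i j : Fin 3 => if i.val + j.val + 1 = 3 then (1 : L) else 0)))) := fun _ => borel _;
    ∀ (f' : TestGp L H) (f : TestG L), 𝔨.Transfer f' f ↔
      ∃ (T : UnitaryGroup.PureTensor L 3 H) (T' : UnitaryGroup.PureTensor L 3 (splitForm L 3)),
        (T.IsTest ∧ T'.IsTest) ∧ ⇑f' = T.eval ∧ ⇑f = T'.eval ∧ (∀ v, T'.loc v = T.loc v ∘ (𝔨.ψ v).symm) ∧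
        Literature.NumberTheory.Rogawski1990.IsArchInnerTransfer L H 𝔨.mGi 𝔨.mqi T.arch T'.arch

open scoped Classical in
/-- **(xi″-c) THE `TransferH` SOCKET IS THE LOCAL Δ-MATCHING PREDICATE** (text; DEFINITIONAL pin, subsumes the forward pins (vi)-H and (xi″)): there is a
finite set `S₁` of finite places (the anchor's `S₀ ∪ S_bad`) such that `TransferH f′ f^H` holds IFF (`f′`, `f^H`) are unramified pure tensors with
`T^H.S ⊆ S₁ ∪ T.S` (unit ↦ unit away from `S₁ ∪ S`, ★ `GlobalTransferAwayH`) AND test∕unramified₂ tensors which are a `Δ_v`-transfer pair at EVERY finite `v`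
and an archimedean Δ-transfer pair for `Tinf`.  Makes «placewise Δ-matching ⇒ `TransferH`» available to consumers (P3's `matchingS`, H-side, modulo the
unit ∕ Hecke fundamental lemma at the unramified places).  Anchor: `⟨S₀ ∪ S_bad, Iff.rfl⟩`. [cite: Rogawski1990, §14.3 pp. 233–234; §4.9 Prop. 4.9.1 p. 55] -/
def PinTransferHIff (Tinf : Literature.NumberTheory.Rogawski1990.ArchTransferFactor L H) : Prop :=
  letI : ∀ (v : HeightOneSpectrum (𝓞 ↥(maximalRealSubfield L))) (a : HLocal L v),
        MeasurableSpace (HLocal L v ⧸ Subgroup.centralizer ({a} : Set (HLocal L v))) := fun _ _ => borel _;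
    haveI : ∀ (v : HeightOneSpectrum (𝓞 ↥(maximalRealSubfield L))) (a : HLocal L v),
        BorelSpace (HLocal L v ⧸ Subgroup.centralizer ({a} : Set (HLocal L v))) := fun _ _ => ⟨rfl⟩;
    letI : ∀ (v : HeightOneSpectrum (𝓞 ↥(maximalRealSubfield L))) (γ : (UnitaryGroup.cmDatum L 3 H).Local v),
        MeasurableSpace ((UnitaryGroup.cmDatum L 3 H).Local v ⧸
          Subgroup.centralizer ({γ} : Set ((UnitaryGroup.cmDatum L 3 H).Local v))) := fun _ _ => borel _;
    haveI : ∀ (v : HeightOneSpectrum (𝓞 ↥(maximalRealSubfield L))) (γ : (UnitaryGroup.cmDatum L 3 H).Local v),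
        BorelSpace ((UnitaryGroup.cmDatum L 3 H).Local v ⧸
          Subgroup.centralizer ({γ} : Set ((UnitaryGroup.cmDatum L 3 H).Local v))) := fun _ _ => ⟨rfl⟩;
    letI : ∀ a : (UnitaryGroup.arch (↥(maximalRealSubfield L)) L (IsCMField.complexConj L) 2
            (Matrix.of fun i j : Fin 2 => if i.val + j.val + 1 = 2 then (1 : L) else 0) ×
          UnitaryGroup.arch (↥(maximalRealSubfield L)) L (IsCMField.complexConj L) 1
            (Matrix.of fun i j : Fin 1 => if i.val + j.val + 1 = 1 then (1 : L) else 0)),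
        MeasurableSpace ((UnitaryGroup.arch (↥(maximalRealSubfield L)) L (IsCMField.complexConj L) 2
            (Matrix.of fun i j : Fin 2 => if i.val + j.val + 1 = 2 then (1 : L) else 0) ×
          UnitaryGroup.arch (↥(maximalRealSubfield L)) L (IsCMField.complexConj L) 1
            (Matrix.of fun i j : Fin 1 => if i.val + j.val + 1 = 1 then (1 : L) else 0)) ⧸
          Subgroup.centralizer ({a} : Set (UnitaryGroup.arch (↥(maximalRealSubfield L)) L (IsCMField.complexConj L) 2
            (Matrix.of fun i j : Fin 2 => if i.val + j.val + 1 = 2 then (1 : L) else 0) ×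
          UnitaryGroup.arch (↥(maximalRealSubfield L)) L (IsCMField.complexConj L) 1
            (Matrix.of fun i j : Fin 1 => if i.val + j.val + 1 = 1 then (1 : L) else 0)))) := fun _ => borel _;
    letI : ∀ γ : UnitaryGroup.arch (↥(maximalRealSubfield L)) L (IsCMField.complexConj L) 3 H,
        MeasurableSpace (UnitaryGroup.arch (↥(maximalRealSubfield L)) L (IsCMField.complexConj L) 3 H ⧸ Subgroup.centralizer ({γ} : Set (UnitaryGroup.arch (↥(maximalRealSubfield L)) L (IsCMField.complexConj L) 3 H))) := fun _ => borel _;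
    ∃ S₁ : Finset (HeightOneSpectrum (𝓞 ↥(maximalRealSubfield L))), ∀ (f' : TestGp L H) (fH : TestH L), 𝔨.TransferH f' fH ↔
      UnitaryGroup.GlobalTransferAwayH L S₁ f' fH ∧
      ∃ (T : UnitaryGroup.PureTensor L 3 H) (TH : UnitaryGroup.PureTensor₂ L (splitForm L 2) (splitForm L 1)),
        (T.IsTest ∧ TH.IsUnramified₂ ∧ (∀ v ∈ TH.S, Literature.NumberTheory.Rogawski1990.IsLocSmooth (TH.loc v)) ∧
          Literature.NumberTheory.Rogawski1990.ArchSmooth₂ L TH.arch) ∧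
        ⇑f' = T.eval ∧ ⇑fH = TH.eval ∧
        (∀ v, Literature.NumberTheory.Rogawski1990.IsLocalDeltaTransfer L H v (𝔨.Δ v) (𝔨.mH v) (𝔨.mG v) (TH.loc v) (T.loc v)) ∧
        Literature.NumberTheory.Rogawski1990.IsArchDeltaTransfer L H Tinf 𝔨.mHi 𝔨.mGi TH.arch T.arch

/-- **(xi-u) THE UNIT FUNDAMENTAL LEMMA OFF A FINITE SET** (text): for all but finitely many finite `v`, `1_{K_{H,v}}` is a `Δ_v`-transfer of `1_{K′_v}` for
the kit's OWN `(Δ_v, m_{H,v}, m_{G′,v})` (★ `IsLocalUnitTransfer`; in the anchor this is the `v ∉ S_bad` clause of ★ `GlobalTransferWithFundamentalLemmaCanonical`,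
[Prop. 4.9.1 (b)] read at the units).  What the H-half of P3's `matchingS` needs at the places where `f^S` is the unit.  Anchor: `⟨S_bad, (hloc v).2.1⟩`.
[cite: Rogawski1990, §4.9 Prop. 4.9.1 (b) p. 55; §14.3 p. 233] -/
def PinLocalUnitTransferOff : Prop :=
  letI : ∀ (v : HeightOneSpectrum (𝓞 ↥(maximalRealSubfield L))) (a : HLocal L v),
        MeasurableSpace (HLocal L v ⧸ Subgroup.centralizer ({a} : Set (HLocal L v))) := fun _ _ => borel _;
    haveI : ∀ (v : HeightOneSpectrum (𝓞 ↥(maximalRealSubfield L))) (a : HLocal L v),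
        BorelSpace (HLocal L v ⧸ Subgroup.centralizer ({a} : Set (HLocal L v))) := fun _ _ => ⟨rfl⟩;
    letI : ∀ (v : HeightOneSpectrum (𝓞 ↥(maximalRealSubfield L))) (γ : (UnitaryGroup.cmDatum L 3 H).Local v),
        MeasurableSpace ((UnitaryGroup.cmDatum L 3 H).Local v ⧸
          Subgroup.centralizer ({γ} : Set ((UnitaryGroup.cmDatum L 3 H).Local v))) := fun _ _ => borel _;
    haveI : ∀ (v : HeightOneSpectrum (𝓞 ↥(maximalRealSubfield L))) (γ : (UnitaryGroup.cmDatum L 3 H).Local v),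
        BorelSpace ((UnitaryGroup.cmDatum L 3 H).Local v ⧸
          Subgroup.centralizer ({γ} : Set ((UnitaryGroup.cmDatum L 3 H).Local v))) := fun _ _ => ⟨rfl⟩;
    ∃ Su : Finset (HeightOneSpectrum (𝓞 ↥(maximalRealSubfield L))), ∀ v ∉ Su,
      Literature.NumberTheory.Rogawski1990.IsLocalUnitTransfer L H v (𝔨.Δ v) (𝔨.mH v) (𝔨.mG v)

section PinnedCanonical

variable [∀ v : HeightOneSpectrum (𝓞 ↥(maximalRealSubfield L)), MeasurableSpace (HLocal L v)] [∀ v : HeightOneSpectrum (𝓞 ↥(maximalRealSubfield L)), BorelSpace (HLocal L v)]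
  [∀ v : HeightOneSpectrum (𝓞 ↥(maximalRealSubfield L)), MeasurableSpace (GpLocal L H v)] [∀ v : HeightOneSpectrum (𝓞 ↥(maximalRealSubfield L)), BorelSpace (GpLocal L H v)]
  [MeasurableSpace (GpInf L H)] [BorelSpace (GpInf L H)] [MeasurableSpace (GInf L)] [BorelSpace (GInf L)]
  [MeasurableSpace (HInf L)] [BorelSpace (HInf L)]

/-- **(ed. 1.19a) ARCHIMEDEAN COHERENCE of the kit's families** `𝔨.mGi`, `𝔨.mqi`, `𝔨.mHi`: torus measures `t′`, `t`, `t_H` making each family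
member at a (`G`-)regular class the Weil quotient `dν ∕ dt` (★ `OrbitalMeasureFamily.IsQuotientOf`), compatible along stable conjugacy, the inner twist (★
`UnitaryGroup.archStableCentralizerEquiv`) and ★ `Rogawski1990.endoEmbArchCentralizer` — the seven conditions of ★ `Rogawski1990.ArchTransfersExistCanonical`
VERBATIM over the kit's FIELDS (LEAD ruling #40; full text: companion § ed. 1.24b). (print: Rogawski1990, §4.3 (4.3.1) p. 43; §1.7 p. 6; §14.2 (14.2.1)
p. 232; §14.3 p. 234) -/
def ArchCoherence (hanis : IsAnisotropic L H) (νGi : Measure (GpInf L H)) (νqi : Measure (GInf L)) (νHi : Measure (HInf L))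
    [IsFiniteMeasureOnCompacts νGi] [νGi.IsMulRightInvariant] [IsFiniteMeasureOnCompacts νqi] [νqi.IsMulRightInvariant]
    [IsFiniteMeasureOnCompacts νHi] [νHi.IsMulRightInvariant] : Prop :=
  letI : ∀ γ : GpInf L H, MeasurableSpace (GpInf L H ⧸ Subgroup.centralizer ({γ} : Set (GpInf L H))) := fun _ => borel _
  haveI : ∀ γ : GpInf L H, BorelSpace (GpInf L H ⧸ Subgroup.centralizer ({γ} : Set (GpInf L H))) := fun _ => ⟨rfl⟩
  letI : ∀ γ : GInf L, MeasurableSpace (GInf L ⧸ Subgroup.centralizer ({γ} : Set (GInf L))) := fun _ => borel _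
  haveI : ∀ γ : GInf L, BorelSpace (GInf L ⧸ Subgroup.centralizer ({γ} : Set (GInf L))) := fun _ => ⟨rfl⟩
  letI : ∀ a : HInf L, MeasurableSpace (HInf L ⧸ Subgroup.centralizer ({a} : Set (HInf L))) := fun _ => borel _
  haveI : ∀ a : HInf L, BorelSpace (HInf L ⧸ Subgroup.centralizer ({a} : Set (HInf L))) := fun _ => ⟨rfl⟩
  ∃ (t' : ∀ γ' : GpInf L H, Measure (Subgroup.centralizer ({γ'} : Set (GpInf L H))))
    (t : ∀ γ : GInf L, Measure (Subgroup.centralizer ({γ} : Set (GInf L))))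
    (tH : ∀ γH : HInf L, Measure (Subgroup.centralizer ({γH} : Set (HInf L)))),
    -- (W′)(W)(W_H): Weil form for the given Haar measures
    𝔨.mGi.IsQuotientOf (fun γ => Literature.NumberTheory.Rogawski1990.IsRegularElt (γ.val : GL (Fin 3) (NumberField.mixedEmbedding.mixedSpace L))) νGi t' ∧
      𝔨.mqi.IsQuotientOf (fun γ => Literature.NumberTheory.Rogawski1990.IsRegularElt (γ.val : GL (Fin 3) (NumberField.mixedEmbedding.mixedSpace L))) νqi t ∧
      𝔨.mHi.IsQuotientOf (Literature.NumberTheory.Rogawski1990.IsArchGRegular L) νHi tH ∧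
    -- (C′): compatibility under stable conjugacy inside `G′_∞`
    (∀ (γ₁ γ₂ : GpInf L H)
        (h₁ : Literature.NumberTheory.Rogawski1990.IsRegularElt (γ₁.val : GL (Fin 3) (NumberField.mixedEmbedding.mixedSpace L)))
        (hc : Literature.NumberTheory.Rogawski1990.Corresponds (UnitaryGroup.conjMixed (↥(maximalRealSubfield L)) L (IsCMField.complexConj L))
          (UnitaryGroup.archFormOf L 3 H) (UnitaryGroup.archFormOf L 3 H) γ₁ γ₂),
        Measure.map ⇑(UnitaryGroup.archStableCentralizerEquiv L (Literature.NumberTheory.Automorphic.Godement.det_ne_zero_of_anisotropic L H hanis)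
          (Literature.NumberTheory.Automorphic.Godement.det_ne_zero_of_anisotropic L H hanis) hc h₁) (t' γ₁) = t' γ₂) ∧
    -- (C): compatibility under stable conjugacy inside `G_∞`
    (∀ (γ₁ γ₂ : GInf L)
        (h₁ : Literature.NumberTheory.Rogawski1990.IsRegularElt (γ₁.val : GL (Fin 3) (NumberField.mixedEmbedding.mixedSpace L)))
        (hc : Literature.NumberTheory.Rogawski1990.Corresponds (UnitaryGroup.conjMixed (↥(maximalRealSubfield L)) L (IsCMField.complexConj L))
          (UnitaryGroup.archFormOf L 3 (Matrix.of fun i j : Fin 3 => if i.val + j.val + 1 = 3 then (1 : L) else 0))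
          (UnitaryGroup.archFormOf L 3 (Matrix.of fun i j : Fin 3 => if i.val + j.val + 1 = 3 then (1 : L) else 0)) γ₁ γ₂),
        Measure.map ⇑(UnitaryGroup.archStableCentralizerEquiv L (UnitaryGroup.isUnit_antidiagOne_det L 3).ne_zero
          (UnitaryGroup.isUnit_antidiagOne_det L 3).ne_zero hc h₁) (t γ₁) = t γ₂) ∧
    -- (C′G): compatibility under the inner twist `G′_∞ ↔ G_∞`
    (∀ (γ' : GpInf L H) (γ : GInf L)
        (h' : Literature.NumberTheory.Rogawski1990.IsRegularElt (γ'.val : GL (Fin 3) (NumberField.mixedEmbedding.mixedSpace L)))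
        (hc : Literature.NumberTheory.Rogawski1990.Corresponds (UnitaryGroup.conjMixed (↥(maximalRealSubfield L)) L (IsCMField.complexConj L))
          (UnitaryGroup.archFormOf L 3 H)
          (UnitaryGroup.archFormOf L 3 (Matrix.of fun i j : Fin 3 => if i.val + j.val + 1 = 3 then (1 : L) else 0)) γ' γ),
        Measure.map ⇑(UnitaryGroup.archStableCentralizerEquiv L (Literature.NumberTheory.Automorphic.Godement.det_ne_zero_of_anisotropic L H hanis)
          (UnitaryGroup.isUnit_antidiagOne_det L 3).ne_zero hc h') (t' γ') = t γ) ∧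
    -- (C_H): compatibility along the endoscopic embedding `ι_∞ : H_∞ → G_∞` at the `G`-regular elements
    (∀ γH : HInf L, Literature.NumberTheory.Rogawski1990.IsArchGRegular L γH →
        Measure.map ⇑(Literature.NumberTheory.Rogawski1990.endoEmbArchCentralizer L γH) (tH γH) =
          t (Literature.NumberTheory.Rogawski1990.endoEmbArch L γH))


/-- **`IsPinned`** — the kit's concrete anchors, one conjunct per pin, each with a NAMED PROJECTION `IsPinned.*` in the API file; new pins are only
ever APPENDED (every projection path unchanged except the previously-last one, which gains `.1`).  Tail since ed. 1.24a₀∕1.24b: the O7 singular-class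
pins and the (M-c) converse-transfer pins, listed in the card § «Pins» (full text: companion § ed. 1.24b).
(print: Rogawski1990, §14.1–14.3 pp. 232–234; §14.5 pp. 237–238; §4.3 pp. 43–44; §4.9 p. 54; §5.4 (5.4.3) pp. 72–73)  (print: Gelbart1975, (9.11); Lemma 10.6) -/
def IsPinned [MeasurableSpace (GpAdelic L H)] [BorelSpace (GpAdelic L H)]
    (ν : Measure (GpAdelic L H)) [ν.IsHaarMeasure] [ν.IsInvInvariant] (Tinf : Literature.NumberTheory.Rogawski1990.ArchTransferFactor L H)
    (νH : ∀ v : HeightOneSpectrum (𝓞 ↥(maximalRealSubfield L)), Measure (HLocal L v)) (νG : ∀ v : HeightOneSpectrum (𝓞 ↥(maximalRealSubfield L)), Measure (GpLocal L H v))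
    [∀ v, IsFiniteMeasureOnCompacts (νH v)] [∀ v, (νH v).IsMulRightInvariant]
    [∀ v, IsFiniteMeasureOnCompacts (νG v)] [∀ v, (νG v).IsMulRightInvariant]
    (νGi : Measure (GpInf L H)) (νqi : Measure (GInf L)) (νHi : Measure (HInf L))
    [IsFiniteMeasureOnCompacts νGi] [νGi.IsMulRightInvariant] [IsFiniteMeasureOnCompacts νqi] [νqi.IsMulRightInvariant]
    [IsFiniteMeasureOnCompacts νHi] [νHi.IsMulRightInvariant] : Prop :=
  (∀ (f' F' : TestGp L H), (∀ x, F' x = mulConv ν (⇑f') (mulStar (⇑f')) x) →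
      ∀ {ι : Type} [Countable ι] (b : HilbertBasis ι ℂ ((UnitaryGroup.cmDatum L 3 H).L2 μ)),
        HasSum (fun i => (‖((UnitaryGroup.cmDatum L 3 H).rightRegular μ).integratedOperator
            ((UnitaryGroup.cmDatum L 3 H).isUnitary_rightRegular μ)
            ((UnitaryGroup.cmDatum L 3 H).isStronglyContinuous_rightRegular_holds μ) ν f' (b i)‖ ^ 2 : ℝ))
          (𝔨.traceGp F').re ∧ (𝔨.traceGp F').im = 0) ∧
  (∀ P : DiscreteAutomorphicRep (UnitaryGroup.cmDatum L 3 H) μ,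
      ((𝔨.mult P : ℕ) : ℕ∞) = ((UnitaryGroup.cmDatum L 3 H).rightRegular μ).multiplicity P.space.toContRep) ∧
  (UnitaryGroup.cmDatum L 3 (splitForm L 3)).IsAutomorphicMeasure 𝔨.μG ∧
  (∀ f' : TestGp L H, 𝔨.Smooth f' ↔ ∃ T : UnitaryGroup.PureTensor L 3 H, T.IsTest ∧ ⇑f' = T.eval) ∧
  (∀ hanis : IsAnisotropic L H, 𝔨.traceGp = UnitaryGroup.diagTrace L 3 H μ ν hanis) ∧
  (∃ S₀ : Finset (HeightOneSpectrum (𝓞 ↥(maximalRealSubfield L))),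
    (∀ v ∉ S₀, ∀ g, 𝔨.ψ v g ∈ UnitaryGroup.cmLocalIntegralLevel L 3 (splitForm L 3) v ↔
      g ∈ UnitaryGroup.cmLocalIntegralLevel L 3 H v) ∧
    (∀ (f' : TestGp L H) (f : TestG L), 𝔨.Transfer f' f → UnitaryGroup.GlobalTransferAway L 3 𝔨.ψ S₀ f' f) ∧
    ∀ (f' : TestGp L H) (fH : TestH L), 𝔨.TransferH f' fH → UnitaryGroup.GlobalTransferAwayH L S₀ f' fH) ∧
  (∀ (g h F' : TestGp L H), (∀ x, F' x = mulConv ν (⇑g) (mulStar (⇑h)) x) →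
      ∀ {ι : Type} [Countable ι] (b : HilbertBasis ι ℂ ((UnitaryGroup.cmDatum L 3 H).L2 μ)),
        HasSum (fun i => inner ℂ
            (((UnitaryGroup.cmDatum L 3 H).rightRegular μ).integratedOperator
              ((UnitaryGroup.cmDatum L 3 H).isUnitary_rightRegular μ)
              ((UnitaryGroup.cmDatum L 3 H).isStronglyContinuous_rightRegular_holds μ) ν h (b i))
            (((UnitaryGroup.cmDatum L 3 H).rightRegular μ).integratedOperator
              ((UnitaryGroup.cmDatum L 3 H).isUnitary_rightRegular μ)
              ((UnitaryGroup.cmDatum L 3 H).isStronglyContinuous_rightRegular_holds μ) ν g (b i)))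
          (𝔨.traceGp F')) ∧
  (letI : ∀ g : GpAdelic L H, MeasurableSpace (GpAdelic L H ⧸ Subgroup.centralizer ({g} : Set (GpAdelic L H))) := fun _ => borel _;
    (∀ c : ConjClasses (UnitaryGroup.cmDatum L 3 H).Rational,
        SMulInvariantMeasure (GpAdelic L H) _ (𝔨.μA c) ∧ IsFiniteMeasureOnCompacts (𝔨.μA c) ∧ 𝔨.μA c ≠ 0) ∧
    ((∀ (c : 𝔨.StClass) (f' : TestGp L H), 𝔨.J c f' = (𝔨.eSt c).orbitalSum (UnitaryGroup.adelicClassOrbitalIntegral L 3 H 𝔨.μA f')) ∧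
      ∀ f' : TestGp L H, (Function.support (UnitaryGroup.adelicClassOrbitalIntegral L 3 H 𝔨.μA f')).Finite) ∧
    ∀ c : 𝔨.StClass, 0 < 𝔨.α c) ∧
  (letI : ∀ γ : UnitaryGroup.arch (↥(maximalRealSubfield L)) L (IsCMField.complexConj L) 3 H,
        MeasurableSpace (UnitaryGroup.arch (↥(maximalRealSubfield L)) L (IsCMField.complexConj L) 3 H ⧸ Subgroup.centralizer ({γ} : Set (UnitaryGroup.arch (↥(maximalRealSubfield L)) L (IsCMField.complexConj L) 3 H))) := fun _ => borel _;
    letI : ∀ γ : UnitaryGroup.arch (↥(maximalRealSubfield L)) L (IsCMField.complexConj L) 3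
          (Matrix.of fun i j : Fin 3 => if i.val + j.val + 1 = 3 then (1 : L) else 0),
        MeasurableSpace (UnitaryGroup.arch (↥(maximalRealSubfield L)) L (IsCMField.complexConj L) 3
          (Matrix.of fun i j : Fin 3 => if i.val + j.val + 1 = 3 then (1 : L) else 0) ⧸
          Subgroup.centralizer ({γ} : Set (UnitaryGroup.arch (↥(maximalRealSubfield L)) L (IsCMField.complexConj L) 3
          (Matrix.of fun i j : Fin 3 => if i.val + j.val + 1 = 3 then (1 : L) else 0)))) := fun _ => borel _;
    𝔨.mGi.IsAdmissibleOn (fun γ => Literature.NumberTheory.Rogawski1990.IsRegularElt (γ.val : GL (Fin 3) (NumberField.mixedEmbedding.mixedSpace L))) ∧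
      𝔨.mqi.IsAdmissibleOn (fun γ => Literature.NumberTheory.Rogawski1990.IsRegularElt (γ.val : GL (Fin 3) (NumberField.mixedEmbedding.mixedSpace L))) ∧
      ∀ (f' : TestGp L H) (f : TestG L), 𝔨.Transfer f' f →
        ∃ (T : UnitaryGroup.PureTensor L 3 H) (T' : UnitaryGroup.PureTensor L 3 (splitForm L 3)),
          (T.IsTest ∧ T'.IsTest) ∧ ⇑f' = T.eval ∧ ⇑f = T'.eval ∧ (∀ v, T'.loc v = T.loc v ∘ (𝔨.ψ v).symm) ∧
          Literature.NumberTheory.Rogawski1990.IsArchInnerTransfer L H 𝔨.mGi 𝔨.mqi T.arch T'.arch) ∧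
  ((∀ v (γ' : (UnitaryGroup.cmDatum L 3 H).Local v),
      Literature.NumberTheory.Rogawski1990.Corresponds (UnitaryGroup.conjLocal L (IsCMField.complexConj L) v)
        ((UnitaryGroup.adelicForm L 3 H).map (UnitaryGroup.adeleToLocal L v))
        ((UnitaryGroup.adelicForm L 3 (splitForm L 3)).map (UnitaryGroup.adeleToLocal L v)) γ' (𝔨.ψ v γ')) ∧
    ∀ v (γ : (UnitaryGroup.cmDatum L 3 (splitForm L 3)).Local v),
      Literature.NumberTheory.Rogawski1990.Corresponds (UnitaryGroup.conjLocal L (IsCMField.complexConj L) v)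
        ((UnitaryGroup.adelicForm L 3 H).map (UnitaryGroup.adeleToLocal L v))
        ((UnitaryGroup.adelicForm L 3 (splitForm L 3)).map (UnitaryGroup.adeleToLocal L v)) ((𝔨.ψ v).symm γ) γ) ∧
  (letI : ∀ (v : HeightOneSpectrum (𝓞 ↥(maximalRealSubfield L))) (a : HLocal L v),
        MeasurableSpace (HLocal L v ⧸ Subgroup.centralizer ({a} : Set (HLocal L v))) := fun _ _ => borel _;
    haveI : ∀ (v : HeightOneSpectrum (𝓞 ↥(maximalRealSubfield L))) (a : HLocal L v),
        BorelSpace (HLocal L v ⧸ Subgroup.centralizer ({a} : Set (HLocal L v))) := fun _ _ => ⟨rfl⟩;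
    letI : ∀ (v : HeightOneSpectrum (𝓞 ↥(maximalRealSubfield L))) (γ : (UnitaryGroup.cmDatum L 3 H).Local v),
        MeasurableSpace ((UnitaryGroup.cmDatum L 3 H).Local v ⧸
          Subgroup.centralizer ({γ} : Set ((UnitaryGroup.cmDatum L 3 H).Local v))) := fun _ _ => borel _;
    haveI : ∀ (v : HeightOneSpectrum (𝓞 ↥(maximalRealSubfield L))) (γ : (UnitaryGroup.cmDatum L 3 H).Local v),
        BorelSpace ((UnitaryGroup.cmDatum L 3 H).Local v ⧸
          Subgroup.centralizer ({γ} : Set ((UnitaryGroup.cmDatum L 3 H).Local v))) := fun _ _ => ⟨rfl⟩;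
    letI : ∀ a : (UnitaryGroup.arch (↥(maximalRealSubfield L)) L (IsCMField.complexConj L) 2
            (Matrix.of fun i j : Fin 2 => if i.val + j.val + 1 = 2 then (1 : L) else 0) ×
          UnitaryGroup.arch (↥(maximalRealSubfield L)) L (IsCMField.complexConj L) 1
            (Matrix.of fun i j : Fin 1 => if i.val + j.val + 1 = 1 then (1 : L) else 0)),
        MeasurableSpace ((UnitaryGroup.arch (↥(maximalRealSubfield L)) L (IsCMField.complexConj L) 2
            (Matrix.of fun i j : Fin 2 => if i.val + j.val + 1 = 2 then (1 : L) else 0) ×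
          UnitaryGroup.arch (↥(maximalRealSubfield L)) L (IsCMField.complexConj L) 1
            (Matrix.of fun i j : Fin 1 => if i.val + j.val + 1 = 1 then (1 : L) else 0)) ⧸
          Subgroup.centralizer ({a} : Set (UnitaryGroup.arch (↥(maximalRealSubfield L)) L (IsCMField.complexConj L) 2
            (Matrix.of fun i j : Fin 2 => if i.val + j.val + 1 = 2 then (1 : L) else 0) ×
          UnitaryGroup.arch (↥(maximalRealSubfield L)) L (IsCMField.complexConj L) 1
            (Matrix.of fun i j : Fin 1 => if i.val + j.val + 1 = 1 then (1 : L) else 0)))) := fun _ => borel _;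
    letI : ∀ γ : UnitaryGroup.arch (↥(maximalRealSubfield L)) L (IsCMField.complexConj L) 3 H,
        MeasurableSpace (UnitaryGroup.arch (↥(maximalRealSubfield L)) L (IsCMField.complexConj L) 3 H ⧸ Subgroup.centralizer ({γ} : Set (UnitaryGroup.arch (↥(maximalRealSubfield L)) L (IsCMField.complexConj L) 3 H))) := fun _ => borel _;
    (∀ v, Literature.NumberTheory.Rogawski1990.IsLocalNondegenerate L H v (𝔨.Δ v) ∧
        (𝔨.mH v).IsAdmissibleOn (Literature.NumberTheory.Rogawski1990.IsLocalGRegular L v) ∧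
        ((𝔨.mG v).IsAdmissibleOn fun γ =>
          Literature.NumberTheory.Rogawski1990.IsRegularElt (γ.val : GL (Fin 3) (UnitaryGroup.LocalRing L v))) ∧
        (𝔨.mH v).IsCanonical (Literature.NumberTheory.Rogawski1990.IsLocalGRegular L v) (νH v) ∧
        (𝔨.mG v).IsCanonical (fun γ =>
          Literature.NumberTheory.Rogawski1990.IsRegularElt (γ.val : GL (Fin 3) (UnitaryGroup.LocalRing L v))) (νG v)) ∧
      Literature.NumberTheory.Rogawski1990.IsAlmostEverywhereTrivial L H 𝔨.Δ ∧
      Literature.NumberTheory.Rogawski1990.SatisfiesProductFormula L H 𝔨.Δ Tinf.Δ ∧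
      𝔨.mHi.IsAdmissibleOn (Literature.NumberTheory.Rogawski1990.IsArchGRegular L) ∧
      𝔨.mGi.IsAdmissibleOn (fun γ => Literature.NumberTheory.Rogawski1990.IsRegularElt (γ.val : GL (Fin 3) (NumberField.mixedEmbedding.mixedSpace L))) ∧
      ∀ (f' : TestGp L H) (fH : TestH L), 𝔨.TransferH f' fH →
        ∃ (T : UnitaryGroup.PureTensor L 3 H) (TH : UnitaryGroup.PureTensor₂ L (splitForm L 2) (splitForm L 1)),
          (T.IsTest ∧ TH.IsUnramified₂ ∧ (∀ v ∈ TH.S, Literature.NumberTheory.Rogawski1990.IsLocSmooth (TH.loc v)) ∧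
            Literature.NumberTheory.Rogawski1990.ArchSmooth₂ L TH.arch) ∧
          ⇑f' = T.eval ∧ ⇑fH = TH.eval ∧
          (∀ v, Literature.NumberTheory.Rogawski1990.IsLocalDeltaTransfer L H v (𝔨.Δ v) (𝔨.mH v) (𝔨.mG v) (TH.loc v) (T.loc v)) ∧
          Literature.NumberTheory.Rogawski1990.IsArchDeltaTransfer L H Tinf 𝔨.mHi 𝔨.mGi TH.arch T.arch) ∧
  (∀ hanis : IsAnisotropic L H, 𝔨.ArchCoherence hanis νGi νqi νHi) ∧
  (letI : ∀ (v : HeightOneSpectrum (𝓞 ↥(maximalRealSubfield L))) (γ : (UnitaryGroup.cmDatum L 3 H).Local v),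
        MeasurableSpace ((UnitaryGroup.cmDatum L 3 H).Local v ⧸
          Subgroup.centralizer ({γ} : Set ((UnitaryGroup.cmDatum L 3 H).Local v))) := fun _ _ => borel _;
    ∀ c : ConjClasses (UnitaryGroup.cmDatum L 3 H).Rational,
      Literature.NumberTheory.Rogawski1990.IsRegularElt ((Quotient.out c).val : GL (Fin 3) L) →
        ∃ S₀ : Finset (HeightOneSpectrum (𝓞 ↥(maximalRealSubfield L))),
          UnitaryGroup.IsNormalisedOff L 3 H 𝔨.mG ((UnitaryGroup.cmDatum L 3 H).toAdelic (Quotient.out c)) S₀) ∧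
  (letI : ∀ g : GpAdelic L H, MeasurableSpace (GpAdelic L H ⧸ Subgroup.centralizer ({g} : Set (GpAdelic L H))) := fun _ => borel _;
    letI : ∀ γ : GpInf L H, MeasurableSpace (GpInf L H ⧸ Subgroup.centralizer ({γ} : Set (GpInf L H))) := fun _ => borel _;
    letI : ∀ (v : HeightOneSpectrum (𝓞 ↥(maximalRealSubfield L))) (γ : (UnitaryGroup.cmDatum L 3 H).Local v),
        MeasurableSpace ((UnitaryGroup.cmDatum L 3 H).Local v ⧸
          Subgroup.centralizer ({γ} : Set ((UnitaryGroup.cmDatum L 3 H).Local v))) := fun _ _ => borel _;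
    ∀ c : ConjClasses (UnitaryGroup.cmDatum L 3 H).Rational,
      Literature.NumberTheory.Rogawski1990.IsRegularElt ((Quotient.out c).val : GL (Fin 3) L) →
        ∃ b : ℝ, 0 < b ∧ 𝔨.μA c = ENNReal.ofReal b • UnitaryGroup.AdelicOrbitalMeasureFamily.ofLocal L 3 H 𝔨.mG 𝔨.mGi c) ∧
  -- (ed. 1.19c₁) the G-side SJ sockets: (xii″) `SJ_G = α · κ_G · Φ^{st,𝐀}_G`, (xii-f) finite support, (xiii-c) `transfersTo` by name, (κ) positivity
  (𝔨.PinSJG 𝔨.κG ∧ 𝔨.PinSJGFinite ∧ 𝔨.PinTransfersTo 𝔨.eStH ∧ 𝔨.PinKappa 𝔨.κG 𝔨.κH ∧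
  -- (ed. 1.19c₂) the H-side SJ sockets: (xiii″) `SJ_H = κ_H · Φ^{st,𝐀}_H` at the kit's `ofLocalAdelicPair mH mHi`, (xiii-f) finite support
  𝔨.PinSJH 𝔨.eStH 𝔨.κH ∧ 𝔨.PinSJHFinite ∧
  -- (ed. 1.20) (κ-v) the VALUES `κ_G = (#{𝒪H ↦ 𝒪} + 1)⁻¹ = |𝓡|⁻¹`, `κ_H(𝒪H) = 2·α(𝒪)·(#{𝒪H′ ↦ 𝒪} + 1)⁻¹` for `𝒪H ↦ 𝒪`
  𝔨.PinKappaValues 𝔨.κG 𝔨.κH ∧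
  -- (ed. 1.21) (xv) the stabilisation package `(A, 𝓡, obs, e, hHasse, hκ)` of the kit's own `Δ` at every regular rational class [Prop. 3.3.1, (4.3.3), (5.4.5)]
  𝔨.PinStabilisationPackage Tinf ∧
  -- (ed. 1.23) (viii⁵) the STABLE β-pin `μA c = α(eSt⁻¹ 𝒪_st(c)) • ofLocal mG mGi c` at every regular rational class [(4.3.1)–(4.3.2), (5.4.1)–(5.4.3)]
  𝔨.PinStableBeta ∧
  -- (ed. 1.24a₀) the SIGN-FREE H-side O7 pins: (xiii‴-cc) `SJ_H` at a class with CENTRAL image, (c-s) [Lemma 14.5.2 (a)] vanishing at the `H`-regular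
  -- `G`-singular classes, (xiii-0) vanishing off the semisimple classes [Prop. 10.1.2 (a) p. 146; Lemma 14.5.2 p. 238; Thm. 14.5.1 (a) p. 238]
  𝔨.PinSJHCentralImage ∧ 𝔨.PinSingularHRegularVanish ∧ 𝔨.PinSJHOffSemisimple ∧
  -- (ed. 1.24a (F-0)) (c-c) [Lemma 14.5.2 (c)], (d-c) [§14.5 p. 239] at the central elements, (vii-c) `ψ_v` is matrix conjugation
  𝔨.PinCentralHVanish ∧ 𝔨.PinCentralValueTransfer ∧ 𝔨.PinPsiConj ∧
  -- (ed. 1.24b (F-1)) (viii⁵-c)(viii⁵-s) the `μA`-mass at the central classes and the `μA`-shape at the singular non-central classes [Prop. 10.1.2 (b); §5.4 (5.4.1)]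
  𝔨.PinMuAMassCentral ∧ 𝔨.PinMuAShapeSingular ∧
  -- (ed. 1.24b (F-1)) (b-s arch) the SIGNED singular archimedean inner transfer [Lemma 14.5.2 (b); (4.1.2); Kottwitz1988 Prop. 2]
  𝔨.PinSingularArchInnerTransfer ∧
  -- (ed. 1.24b (F-2)⊕(F-1)) (xiii″-s ⊗ b-s κ-mass) ONE scalar `m_H` for `SJ_H` at the scalar-pair preimage AND the κ-mass of the transfer [Lemma 14.5.2 (b); Prop. 10.1.2 (a); Kottwitz1988 Thm. 1]
  𝔨.PinSingularEndoscopicMass ∧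
  -- (ed. 1.24b) (F-3) the `SJ_G` trichotomy: (xii‴-c) central classes, (xii″-s) split-singular classes SIGNED by Kottwitz's `e_𝐀` [Prop. 10.1.2 (b); (4.1.2)]
  𝔨.PinSJGCentral ∧ 𝔨.PinSJGSingular ∧
  -- (ed. 1.24b) (M-c) the CONVERSE transfer pins: (ix′-c) `Transfer` iff local matching, (xi″-c) `TransferH` iff local Δ-matching, (xi‴-c) unit transfer off a finite set [§14.2 (14.2.1); §4.9 Prop. 4.9.1]
  𝔨.PinTransferIff ∧ 𝔨.PinTransferHIff Tinf ∧ 𝔨.PinLocalUnitTransferOff ∧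
  -- (ed. 1.24b) (ix-s) the four family riders at the non-regular classes, bundled (O7 WORD #64: LAST)
  𝔨.PinSingularFamilies)


end PinnedCanonical

/-! ### §1.2 Matching and the derived global distributions [Rogawski1990, pp. 232–241] -/

/-- `J_{G′}(f′) = Σ_{𝒪_st} J(𝒪_st, f′)` [§14.5 pp. 237–238] (a `finsum`; support-finiteness is part of T1a). (print: Rogawski1990, §14.5 p. 237) -/
def JGp (f' : TestGp L H) : ℂ := ∑ᶠ c : 𝔨.StClass, 𝔨.J c f'

/-- `SJ_G(f) = Σ_{𝒪_st} SJ(𝒪_st, f)` [pp. 240–241]. (print: Rogawski1990, §14.5 pp. 240–241) -/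
def SJGtot (f : TestG L) : ℂ := ∑ᶠ c : 𝔨.StClass, 𝔨.SJG c f

/-- `SJ_H(f^H) = Σ_{𝒪′_st} SJ(𝒪′_st, f^H)` [pp. 240–241]. (print: Rogawski1990, §14.5 pp. 240–241) -/
def SJHtot (fH : TestH L) : ℂ := ∑ᶠ c' : 𝔨.StClassH, 𝔨.SJH c' fH

/-- `Σ_{𝒪′_st ↦ 𝒪_st} SJ(𝒪′_st, f^H)` [Thm. 14.5.1 (a)]. (print: Rogawski1990, Thm. 14.5.1 (a) p. 238) -/
def SJHover (c : 𝔨.StClass) (fH : TestH L) : ℂ := ∑ᶠ c' : {c' : 𝔨.StClassH // 𝔨.transfersTo c' c}, 𝔨.SJH c'.1 fH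

/-- `Σ_Π n(Π) Tr Π(f)` [Thm. 14.6.1] (a `tsum`; summability is part of T1e). (print: Rogawski1990, Thm. 14.6.1 p. 241) -/
def specG (f : TestG L) : ℂ := ∑' P : 𝔨.PacketG, 𝔨.nG P * 𝔨.trG P f

/-- `Σ_ρ n(ρ) Tr ρ(f^H)` [Thm. 14.6.1]. (print: Rogawski1990, Thm. 14.6.1 p. 241) -/
def specH (fH : TestH L) : ℂ := ∑' r : 𝔨.PacketH, 𝔨.nH r * 𝔨.trH r fH

/-! ## §2 The seven NAMED INTERMEDIATE IDENTITIES — dictionary letters (layer (L)), nothing asserted -/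

/-- **T1a — simple trace formula for the anisotropic `G′`** [Rogawski1990, §14.5 pp. 237–238]: `θ_{G′}(f′) = J_{G′}(f′)`, the O-expansion
finitely supported in the stable classes for each `f′`. (print: Rogawski1990, §14.5 pp. 237–238) -/
def SimpleTraceFormula : Prop :=
  ∀ f' : TestGp L H, (Function.support fun c : 𝔨.StClass => 𝔨.J c f').Finite ∧ 𝔨.traceGp f' = 𝔨.JGp f'

/-- **T1b — stabilisation of the elliptic terms** [Rogawski1990, Thm. 14.5.1 (a) p. 238; Lemma 14.5.2; pp. 240–241]: for matching `(f′, f, f^H)`,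
class by class `J(𝒪_st, f′) = SJ(𝒪_st, f) + ½ Σ_{𝒪′_st ↦ 𝒪_st} SJ(𝒪′_st, f^H)`, and summed `J_{G′}(f′) = SJ_G(f) + ½ SJ_H(f^H)`.
(print: Rogawski1990, Thm. 14.5.1 (a) p. 238; pp. 240–241) (print: Langlands1983) (print: Kottwitz1988, Prop. 2) -/
def EllipticStabilisation : Prop :=
  ∀ (f' : TestGp L H) (f : TestG L) (fH : TestH L), 𝔨.Matches f' f fH →
    (∀ c : 𝔨.StClass, 𝔨.J c f' = 𝔨.SJG c f + (1 / 2 : ℂ) * 𝔨.SJHover c fH) ∧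
    𝔨.JGp f' = 𝔨.SJGtot f + (1 / 2 : ℂ) * 𝔨.SJHtot fH

/-- **T1c — stabilised trace formulas of the quasi-split `G` and `H`** [Rogawski1990, pp. 240–241; Thm. 10.3.1; Prop. 11.2.1]:
`SJ_G(f) = Sθ_G(f) + Sθ_M(f) − SJ_M(f)`, `SJ_H(f^H) = Sθ_H(f^H) + Sθ_{M_H}(f^H) − SJ_{M_H}(f^H)` on transfers of `G′`-functions.
(print: Rogawski1990, §14.5 pp. 240–241; Thm. 10.3.1; Prop. 11.2.1) -/
def QuasiSplitStableTraceFormulas : Prop :=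
  ∀ (f' : TestGp L H) (f : TestG L) (fH : TestH L), 𝔨.Matches f' f fH →
    𝔨.SJGtot f = 𝔨.SθG f + 𝔨.SθM f - 𝔨.SJM f ∧ 𝔨.SJHtot fH = 𝔨.SθH fH + 𝔨.SθMH fH - 𝔨.SJMH fH

/-- **T1d — cancellation of the `M`-terms** [Rogawski1990, (14.5.1) pp. 240–241; Cor. 9.3.4; Prop. 9.4.2]:
`[Sθ_M(f) + ½ Sθ_{M_H}(f^H)] − [SJ_M(f) + ½ SJ_{M_H}(f^H)] = 0` for transfers of `G′`-functions (`S₀ ≠ ∅`). (print: Rogawski1990, §14.5 (14.5.1) pp. 240–241) -/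
def MTermCancellation : Prop :=
  ∀ (f' : TestGp L H) (f : TestG L) (fH : TestH L), 𝔨.Matches f' f fH →
    (𝔨.SθM f + (1 / 2 : ℂ) * 𝔨.SθMH fH) - (𝔨.SJM f + (1 / 2 : ℂ) * 𝔨.SJMH fH) = 0

/-- **T1e — spectral expansion of `Sθ_G`** [Rogawski1990, pp. 240–241 (Prop. 13.6.2 + Thm. 13.3.7); Chs 11–13; ArthurClozel1989; MoeglinWaldspurger1989]:
on transfers `f` of smooth `G′`-functions, `Σ_Π n(Π) Tr Π(f)` converges absolutely and equals `Sθ_G(f)`. (Caveat on `n(Π(ξ))`: [Rogawski1992].)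
(print: Rogawski1990, Thm. 14.6.1 proof p. 241; Prop. 13.6.2; Thm. 13.3.7) -/
def StableSpectralExpansionG : Prop :=
  ∀ (f' : TestGp L H) (f : TestG L), 𝔨.Smooth f' → 𝔨.Transfer f' f →
    Summable (fun P : 𝔨.PacketG => 𝔨.nG P * 𝔨.trG P f) ∧ 𝔨.SθG f = 𝔨.specG f

/-- **T1f — spectral expansion of `Sθ_H`** [Rogawski1990, pp. 240–241 (Props. 13.6.1, 11.2.1)]: on transfers `f^H`, `Σ_ρ n(ρ) Tr ρ(f^H)` converges
absolutely and equals `Sθ_H(f^H)`. (print: Rogawski1990, Thm. 14.6.1 proof p. 241; Prop. 13.6.1; Prop. 11.2.1) -/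
def StableSpectralExpansionH : Prop :=
  ∀ (f' : TestGp L H) (fH : TestH L), 𝔨.Smooth f' → 𝔨.TransferH f' fH →
    Summable (fun r : 𝔨.PacketH => 𝔨.nH r * 𝔨.trH r fH) ∧ 𝔨.SθH fH = 𝔨.specH fH

/-- **T1g — existence of transfers** [Rogawski1990, §14.2 p. 233; §14.3 pp. 233–234; §4.9–4.13]: every SMOOTH `f′` has a matching pair `(f, f′^H)`
(local transfer (14.2.1); fundamental lemma for `U(3)` and `U(2) × U(1)`; archimedean transfer at `S₀` — Shelstad, Clozel–Delorme).
(print: Rogawski1990, §14.2 p. 233; §14.3 pp. 233–234; §4.9–4.13) (print: LanglandsShelstad1987) -/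
def TransferExistence : Prop :=
  ∀ f' : TestGp L H, 𝔨.Smooth f' → ∃ (f : TestG L) (fH : TestH L), 𝔨.Matches f' f fH

/-- **The seven identities as one hypothesis bundle** (how the integrator's fold quantifies: «for every kit satisfying the printed laws»).
(print: Rogawski1990, §§14.2–14.6) -/
structure LawsT1 : Prop where
  simpleTraceFormula : 𝔨.SimpleTraceFormula
  ellipticStabilisation : 𝔨.EllipticStabilisation
  quasiSplitStableTraceFormulas : 𝔨.QuasiSplitStableTraceFormulas
  mTermCancellation : 𝔨.MTermCancellation
  stableSpectralExpansionG : 𝔨.StableSpectralExpansionG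
  stableSpectralExpansionH : 𝔨.StableSpectralExpansionH
  transferExistence : 𝔨.TransferExistence

/-! ## §3 The heads -/

/-- **[Rogawski1990, Thm. 14.5.1 (b) p. 238]** `θ_{G′}(f′) = Sθ_G(f) + ½ Sθ_H(f′^H)` for matching triples. (print: Rogawski1990, Thm. 14.5.1 (b) p. 238) -/
def Thm1451b : Prop :=
  ∀ (f' : TestGp L H) (f : TestG L) (fH : TestH L), 𝔨.Matches f' f fH →
    𝔨.traceGp f' = 𝔨.SθG f + (1 / 2 : ℂ) * 𝔨.SθH fH

/-- **THE HEAD `InnerFormStableTraceIdentity`** = [Rogawski1990, Thm. 14.6.1 p. 241, (14.6.1)] (name per ENGINE-INTERFACES §1): for every smooth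
`f′` and every matching `(f, f′^H)`, `Tr ρ_d(f′) = Σ_Π n(Π) Tr Π(f) + ½ Σ_ρ n(ρ) Tr ρ(f′^H)`, both series absolutely convergent.
(print: Rogawski1990, Thm. 14.6.1 p. 241) -/
def InnerFormStableTraceIdentity : Prop :=
  ∀ (f' : TestGp L H) (f : TestG L) (fH : TestH L), 𝔨.Smooth f' → 𝔨.Matches f' f fH →
    Summable (fun P : 𝔨.PacketG => 𝔨.nG P * 𝔨.trG P f) ∧ Summable (fun r : 𝔨.PacketH => 𝔨.nH r * 𝔨.trH r fH) ∧
    𝔨.traceGp f' = 𝔨.specG f + (1 / 2 : ℂ) * 𝔨.specH fH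

/-- (14.6.1) is NON-VACUOUS: every smooth `f′` has a matching pair for which it holds. (print: Rogawski1990, §14.2–14.3; Thm. 14.6.1 p. 241) -/
def InnerFormStableTraceIdentityNonvacuous : Prop :=
  ∀ f' : TestGp L H, 𝔨.Smooth f' → ∃ (f : TestG L) (fH : TestH L), 𝔨.Matches f' f fH ∧
    𝔨.traceGp f' = 𝔨.specG f + (1 / 2 : ℂ) * 𝔨.specH fH

/-! ### §3.1 The printed deductions (kernel-checked, no `sorry`) -/

/-- **[Rogawski1990, Thm. 14.5.1 (b)] from T1a–T1d** — pp. 240–241: `θ_{G′} = J_{G′}` (T1a) `= SJ_G + ½ SJ_H` (T1b) `= [Sθ_G + ½ Sθ_H] +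
[M-terms]` (T1c), the `M`-terms vanish (T1d). (print: Rogawski1990, Thm. 14.5.1 (b) p. 238; pp. 240–241) -/
theorem thm1451b_of_laws (ha : 𝔨.SimpleTraceFormula) (hb : 𝔨.EllipticStabilisation) (hc : 𝔨.QuasiSplitStableTraceFormulas)
    (hd : 𝔨.MTermCancellation) : 𝔨.Thm1451b := by
  intro f' f fH hm
  have h1 : 𝔨.traceGp f' = 𝔨.JGp f' := (ha f').2
  have h2 : 𝔨.JGp f' = 𝔨.SJGtot f + (1 / 2 : ℂ) * 𝔨.SJHtot fH := (hb f' f fH hm).2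
  obtain ⟨h3, h4⟩ := hc f' f fH hm
  have h5 := hd f' f fH hm
  rw [h1, h2, h3, h4]
  linear_combination h5

/-- **[Rogawski1990, Thm. 14.6.1] from T1a–T1f** — pp. 240–241: «By Theorem 14.5.1 … `Sθ(f)` is equal to `Σ n(Π) Tr(Π(f))` … `Sθ_H(f′^H)` is equal to
`Σ n(ρ) Tr(ρ(f^H))`». (print: Rogawski1990, Thm. 14.6.1 p. 241) -/
theorem innerFormStableTraceIdentity_of_laws (h : 𝔨.LawsT1) : 𝔨.InnerFormStableTraceIdentity := by
  intro f' f fH hs hm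
  obtain ⟨hsG, heG⟩ := h.stableSpectralExpansionG f' f hs hm.1
  obtain ⟨hsH, heH⟩ := h.stableSpectralExpansionH f' fH hs hm.2
  refine ⟨hsG, hsH, ?_⟩
  rw [𝔨.thm1451b_of_laws h.simpleTraceFormula h.ellipticStabilisation h.quasiSplitStableTraceFormulas h.mTermCancellation
    f' f fH hm, heG, heH]

/-- Non-vacuity of (14.6.1) from the laws (T1g supplies the partners). (print: Rogawski1990, §14.2–14.3; Thm. 14.6.1 p. 241) -/
theorem nonvacuous_of_laws (h : 𝔨.LawsT1) : 𝔨.InnerFormStableTraceIdentityNonvacuous := by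
  intro f' hs
  obtain ⟨f, fH, hm⟩ := h.transferExistence f' hs
  exact ⟨f, fH, hm, (𝔨.innerFormStableTraceIdentity_of_laws h f' f fH hs hm).2.2⟩

end ComparisonKit

/-! ### §3.9 (ed. 1.20) The anchored SJ constants `κ_G`, `κ_H` — VALUES, on the concrete stable-class types -/

/-- **(ed. 1.20) the anchored `κ_G`**: `κ_G(𝒪) := (#{𝒪H ↦ 𝒪} + 1)⁻¹ = |𝓡(𝒪)|⁻¹` (choice-free; the count is finite,
`StableClassH.finite_subtype_transfersTo_antidiagOne`, and `≤ 3`). [Rogawski1990, §5.4 (5.4.5) pp. 72–73] -/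
def anchorKappaG (𝒪 : Literature.NumberTheory.Rogawski1990.StableClass (cmConjRingHom L) H) : ℝ :=
  ((Nat.card {𝒪H : Literature.NumberTheory.Rogawski1990.StableClassH (cmConjRingHom L) (splitForm L 2) (splitForm L 1) //
      𝒪H.TransfersTo H Literature.NumberTheory.Rogawski1990.endoForm_antidiagOne 𝒪} + 1 : ℕ) : ℝ)⁻¹

open scoped Classical in
/-- **(ed. 1.20) the anchored `κ_H`**: `κ_H(𝒪H) := 2 · κ_G(𝒪)` at the unique (`StableClass.eq_of_corresponds_right`) class `𝒪` of `G′` that `𝒪H`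
transfers to, for a WEIGHT `α` on the stable classes of `G′` (ed. 1.23: the anchored kit's `α = w.α`; ed. 1.20–1.22: `α = 1`); the recorded placeholder `2`
off the transfer image (where T1b does not read `κ_H`). [Rogawski1990, §5.4 (5.4.3) p. 72; Thm. 14.5.1 (a) p. 238] -/
def anchorKappaH (α : Literature.NumberTheory.Rogawski1990.StableClass (cmConjRingHom L) H → ℝ)
    (𝒪H : Literature.NumberTheory.Rogawski1990.StableClassH (cmConjRingHom L) (splitForm L 2) (splitForm L 1)) : ℝ :=
  if h : ∃ 𝒪 : Literature.NumberTheory.Rogawski1990.StableClass (cmConjRingHom L) H,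
      𝒪H.TransfersTo H Literature.NumberTheory.Rogawski1990.endoForm_antidiagOne 𝒪 then 2 * α h.choose * anchorKappaG L H h.choose else 2

/-- `κ_G(𝒪) > 0`. [cite: Rogawski1990, §5.4 (5.4.3) p. 72] -/
theorem anchorKappaG_pos (𝒪 : Literature.NumberTheory.Rogawski1990.StableClass (cmConjRingHom L) H) : 0 < anchorKappaG L H 𝒪 := by
  unfold anchorKappaG
  positivity

/-- `κ_H(𝒪H) > 0` for a positive weight. [cite: Rogawski1990, §5.4 (5.4.3) p. 72] -/
theorem anchorKappaH_pos {α : Literature.NumberTheory.Rogawski1990.StableClass (cmConjRingHom L) H → ℝ} (hα : ∀ 𝒪, 0 < α 𝒪)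
    (𝒪H : Literature.NumberTheory.Rogawski1990.StableClassH (cmConjRingHom L) (splitForm L 2) (splitForm L 1)) :
    0 < anchorKappaH L H α 𝒪H := by
  unfold anchorKappaH
  split_ifs with h
  · exact mul_pos (mul_pos two_pos (hα _)) (anchorKappaG_pos L H _)
  · exact two_pos

/-- **The anchored `κ_H` at a transferring class**: `𝒪H ↦ 𝒪 ⇒ κ_H(𝒪H) = 2 · α(𝒪) · (#{𝒪H′ ↦ 𝒪} + 1)⁻¹` (uniqueness of the target class,
★ `StableClass.eq_of_corresponds_right`). [cite: Rogawski1990, §14.1 p. 232; §5.4 (5.4.3) p. 72] -/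
theorem anchorKappaH_eq_of_transfersTo (α : Literature.NumberTheory.Rogawski1990.StableClass (cmConjRingHom L) H → ℝ)
    {𝒪H : Literature.NumberTheory.Rogawski1990.StableClassH (cmConjRingHom L) (splitForm L 2) (splitForm L 1)}
    {𝒪 : Literature.NumberTheory.Rogawski1990.StableClass (cmConjRingHom L) H}
    (h𝒪 : 𝒪H.TransfersTo H Literature.NumberTheory.Rogawski1990.endoForm_antidiagOne 𝒪) :
    anchorKappaH L H α 𝒪H = 2 * α 𝒪 * ((Nat.card {𝒪H' : Literature.NumberTheory.Rogawski1990.StableClassH (cmConjRingHom L) (splitForm L 2) (splitForm L 1) //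
      𝒪H'.TransfersTo H Literature.NumberTheory.Rogawski1990.endoForm_antidiagOne 𝒪} + 1 : ℕ) : ℝ)⁻¹ := by
  classical
  have hex : ∃ 𝒪' : Literature.NumberTheory.Rogawski1990.StableClass (cmConjRingHom L) H,
      𝒪H.TransfersTo H Literature.NumberTheory.Rogawski1990.endoForm_antidiagOne 𝒪' := ⟨𝒪, h𝒪⟩
  have hc : hex.choose = 𝒪 := Literature.NumberTheory.Rogawski1990.StableClass.eq_of_corresponds_right hex.choose_spec h𝒪
  unfold anchorKappaH
  rw [dif_pos hex, hc]
  rfl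

end Summit.HodgeConjecture.HodgeConjecture.Cruxes.H413.F0T1InnerFormTraceIdentity
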